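import Mathlib.GroupTheory.Perm.ViaEmbedding
import Mathlib.Data.Finset.Sort
import Literature.RepresentationTheory.FiniteGroups.InterchangeDirichletForm
import HarnessLib

/-!
# The octopus inequality (Caputo–Liggett–Richthammer, Theorem 2.3)

Topic `Literature/RepresentationTheory/FiniteGroups`. The technical heart of the proof of Aldous'
spectral gap conjecture (Caputo, Liggett, Richthammer, *Proof of Aldous' spectral gap conjecture*,
J. Amer. Math. Soc. 23 (2010), §3): for non-negative rates `c_y` on the edges of the star at a vertex
`x` of a weighted graph and every function `f` on the symmetric group,
`∑_y c_{xy} ν[(∇_{xy} f)²] ≥ ∑_{yz} (c_{xy}c_{xz}/∑_w c_{xw}) ν[(∇_{yz} f)²]`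
(`octopus_inequality`, vertex `x = 0` of `Fin (m+1)`, in the left-regular convention
`∇_{uv} f(τ) = f((uv)τ) − f(τ)` of the tree's `interchangeLaplacian`; multiplied through by `∑_w c_{xw}`).
PROVED here, following CLR §3 step by step:

* reformulation (CLR (relcoeff), (octopus2), (defC)): with `c_0 := −∑_{y} c_y` the inequality reads
  `∑_{u<v} c_uc_v ∑_τ ‖f((uv)τ) − f(τ)‖² ≤ 0` (`octopus_symm`), i.e. `Re⟪f, Θ f⟫ ≥ −c‖f‖²` for
  `Θ = ∑_{u<v} c_uc_v λ((uv))` (`theta`, `re_l2Inner_theta_ge`), `c = −∑_{u<v} c_uc_v = ½∑ c_v²`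
  (`two_mul_sum_prs`);
* the even/odd block decomposition of CLR §3.1 (`evenPart`, `oddPart`,
  `re_l2Inner_theta_eq_two_mul`) and the polarisation bound reduce this to
  `‖Θ g‖² ≤ c²‖g‖²`, i.e. `C' = c² − Θ² ≥ 0` (`re_l2Inner_theta_theta_le`);
* CLR Lemma 3.1 (`theta_mul_theta`, `theta_sq_scalar`): `c² − Θ² = ∑_{|J|=4} (−c_J) A^J` in `ℂ[𝔖ₙ]`,
  where `A^J` (`octAset J`, `octA ι`) is the transport along the increasing enumeration of `J` of
  `A = 3·𝟙_V − 𝟙_{𝔄₄} ∈ ℂ[𝔖₄]` (`A4`; `2` on the identity and the double transpositions, `−1` on the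
  `3`-cycles, CLR (defmat), (A4)); the scalar `c²` is identified by acting on constants
  (`theta_sq_scalar`) instead of CLR's identity for `(∑ c_ic_j)² − ∑(c_ic_j)²`;
* CLR Lemma 3.2 (`A4_mul_A4`, `octA_mul_octA`, `re_l2Inner_regOp_octA_nonneg`): `A² = 12A`, hence
  `A^J ≥ 0`, from `𝟙_V² = 4𝟙_V`, `𝟙_{𝔄₄}² = 12𝟙_{𝔄₄}`, `𝟙_V𝟙_{𝔄₄} = 𝟙_{𝔄₄}𝟙_V = 4𝟙_{𝔄₄}` (the finite
  facts about `𝔖₄` — closure of `V` and `𝔄₄`, normality — are decided by `decide`);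
* CLR Lemma 3.3 (`B5_mul_B5`, `octB_mul_octB`, `re_l2Inner_regOp_octB_nonneg`): for
  `B = A⁽¹⁾+A⁽²⁾+A⁽³⁾+A⁽⁴⁾−A⁽⁰⁾ ∈ ℂ[𝔖₅]`, `B² = 24B`, hence `B^K ≥ 0`; the key relation (B5)
  `B A⁽⁰⁾ = 0` (`B5_mul_Aface_zero`) is proved by regrouping `B = 8 + 2·Yd − 2·𝟙_{V₀}` with
  `Yd = ∑_a (0a)(T − 2U_a)` (`B5_eq`) and the absorption of the tentacles `T − 2U_a` by `𝟙_{V₀}` and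
  `𝟙_{𝔄₄⁽⁰⁾}` (`tentacle_mul_eq_zero`), then transported to all `A⁽ⁱ⁾` by conjugation
  (`conjAlg_Aface`, CLR: "by symmetry");
* CLR Lemma 3.4 (`sum_weight_qset_nonpos`): `∑_J (−c_J)⟨g, A^J g⟩ ≥ 0` by bounding the `4`-sets
  avoiding `0` through `B^{J∪{0}} ≥ 0` (`qset_le_sum_qset_insert`) and regrouping.

## References

* P. Caputo, T. M. Liggett, T. Richthammer, *Proof of Aldous' spectral gap conjecture*, J. Amer.
  Math. Soc. 23 (2010) 831–851, arXiv:0906.1238: Theorem 2.3, §3 (Lemmas 3.1–3.4, eqs. (octopus2),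
  (defC), (cor), (defmat), (A4), (B5)). [CaputoLiggettRichthammer2010]

## Mathlib and tree

Mathlib: `MonoidAlgebra` (`of`, `mapDomainAlgHom`, `induction_on`), `Equiv.Perm.viaEmbeddingHom`,
`Finset.orderEmbOfFin` (`range_orderEmbOfFin`, `orderEmbOfFin_unique'`, `map_orderEmbOfFin_univ`),
`Fin.succAboveEmb`, `Fin.cons_injective_iff`, `Equiv.Perm.sign_swap`, `Representation.asAlgebraHom`,
`decide` on `Equiv.Perm (Fin 4)` / `(Fin 5)`. Tree: `l2Inner`, `l2NormSq`, `transpDirichlet`,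
`two_mul_re_l2Inner_ge`, `l2Inner_shift_right` (`InterchangeDirichletForm.lean`), `permLeftRegular`
(`AldousLambdaOne.lean`).
-/

noncomputable section

open scoped BigOperators ComplexConjugate
open Equiv Finset

namespace Literature.RepresentationTheory.FiniteGroups

namespace Octopus

/-! ### Group-algebra bookkeeping: sums of group elements over multiplicatively closed sets -/

section GroupAlgebra

variable {G : Type*} [Group G]

/-- `𝟙_S := ∑_{g ∈ S} g ∈ ℂ[G]`. [folklore] -/
def setSum (S : Finset G) : MonoidAlgebra ℂ G := ∑ g ∈ S, MonoidAlgebra.of ℂ G g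

/-- Unfolding lemma for `setSum`. [folklore] -/
theorem setSum_def (S : Finset G) : setSum S = ∑ g ∈ S, MonoidAlgebra.of ℂ G g := rfl

/-- Left multiplication by an element of a multiplicatively closed finite set `S` (a finite
subgroup) fixes `𝟙_S`. [folklore] -/
theorem of_mul_setSum {S : Finset G} (hS : ∀ g ∈ S, ∀ h ∈ S, g * h ∈ S) {g : G} (hg : g ∈ S) :
    MonoidAlgebra.of ℂ G g * setSum S = setSum S := by
  rw [setSum, Finset.mul_sum]
  simp only [← map_mul]
  -- `h ↦ g h` is a bijection of `S`
  refine Finset.sum_nbij (fun h => g * h) (fun h hh => hS g hg h hh) ?_ ?_ (fun _ _ => rfl)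
  · intro h₁ _ h₂ _ h
    exact mul_left_cancel h
  · intro k hk
    have hsurj : Set.SurjOn (fun h => g * h) S S := by
      refine Finset.surjOn_of_injOn_of_card_le _ (fun h hh => hS g hg h hh)
        (fun h₁ _ h₂ _ h => mul_left_cancel h) le_rfl
    exact hsurj hk

/-- Right multiplication by an element of a multiplicatively closed finite set fixes `𝟙_S`.
[folklore] -/
theorem setSum_mul_of {S : Finset G} (hS : ∀ g ∈ S, ∀ h ∈ S, g * h ∈ S) {g : G} (hg : g ∈ S) :
    setSum S * MonoidAlgebra.of ℂ G g = setSum S := by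
  rw [setSum, Finset.sum_mul]
  simp only [← map_mul]
  refine Finset.sum_nbij (fun h => h * g) (fun h hh => hS h hh g hg) ?_ ?_ (fun _ _ => rfl)
  · intro h₁ _ h₂ _ h
    exact mul_right_cancel h
  · intro k hk
    have hsurj : Set.SurjOn (fun h => h * g) S S := by
      refine Finset.surjOn_of_injOn_of_card_le _ (fun h hh => hS h hh g hg)
        (fun h₁ _ h₂ _ h => mul_right_cancel h) le_rfl
    exact hsurj hk

/-- If `T ⊆ S` with `S` multiplicatively closed then `𝟙_T 𝟙_S = |T| 𝟙_S`. [folklore] -/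
theorem setSum_mul_setSum_of_subset {S T : Finset G} (hS : ∀ g ∈ S, ∀ h ∈ S, g * h ∈ S)
    (hT : T ⊆ S) : setSum T * setSum S = (T.card : ℂ) • setSum S :=
  calc setSum T * setSum S = ∑ g ∈ T, MonoidAlgebra.of ℂ G g * setSum S := Finset.sum_mul _ _ _
    _ = ∑ g ∈ T, setSum S := Finset.sum_congr rfl fun g hg => of_mul_setSum hS (hT hg)
    _ = (T.card : ℂ) • setSum S := by rw [Finset.sum_const, Nat.cast_smul_eq_nsmul]

/-- If `T ⊆ S` with `S` multiplicatively closed then `𝟙_S 𝟙_T = |T| 𝟙_S`. [folklore] -/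
theorem setSum_mul_setSum_of_subset' {S T : Finset G} (hS : ∀ g ∈ S, ∀ h ∈ S, g * h ∈ S)
    (hT : T ⊆ S) : setSum S * setSum T = (T.card : ℂ) • setSum S :=
  calc setSum S * setSum T = ∑ g ∈ T, setSum S * MonoidAlgebra.of ℂ G g := Finset.mul_sum _ _ _
    _ = ∑ g ∈ T, setSum S := Finset.sum_congr rfl fun g hg => setSum_mul_of hS (hT hg)
    _ = (T.card : ℂ) • setSum S := by rw [Finset.sum_const, Nat.cast_smul_eq_nsmul]

/-- **`𝟙_S · 𝟙_S = |S| 𝟙_S`** for a multiplicatively closed finite set (a finite subgroup).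
[folklore] -/
theorem setSum_mul_setSum {S : Finset G} (hS : ∀ g ∈ S, ∀ h ∈ S, g * h ∈ S) :
    setSum S * setSum S = (S.card : ℂ) • setSum S :=
  setSum_mul_setSum_of_subset hS le_rfl

/-- Push-forward of `𝟙_S` along a group homomorphism injective on `S`. [folklore] -/
theorem mapDomain_setSum {H : Type*} [Group H] [DecidableEq H] (φ : G →* H) (S : Finset G)
    (hφ : Set.InjOn φ S) :
    MonoidAlgebra.mapDomainAlgHom ℂ ℂ φ (setSum S) = setSum (S.image φ) := by
  rw [setSum, setSum, map_sum, Finset.sum_image hφ]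
  refine Finset.sum_congr rfl fun g _ => ?_
  rw [MonoidAlgebra.mapDomainAlgHom_apply, MonoidAlgebra.of_apply, MonoidAlgebra.mapDomain_single,
    MonoidAlgebra.of_apply]

end GroupAlgebra

/-! ### The concrete layer in `ℂ[𝔖₄]`: Klein four-group, `𝔄₄`, and `A = 3·𝟙_V − 𝟙_{𝔄₄}` -/

section S4

/-- The permutation `(0 1)(2 3)` of `Fin 4`. [folklore] -/
def kα : Perm (Fin 4) := swap 0 1 * swap 2 3
/-- The permutation `(0 2)(1 3)` of `Fin 4`. [folklore] -/
def kβ : Perm (Fin 4) := swap 0 2 * swap 1 3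
/-- The permutation `(0 3)(1 2)` of `Fin 4`. [folklore] -/
def kγ : Perm (Fin 4) := swap 0 3 * swap 1 2

/-- The Klein four-group `V = {1, (01)(23), (02)(13), (03)(12)} ⊂ 𝔖₄` as a finite set
(CLR §3.2, proof of Lemma 3.2: "`H := {id, (01)(23), (02)(13), (03)(12)}` is a subgroup").
[cite: CaputoLiggettRichthammer2010, §3.2 Lemma 3.2 (proof)] -/
def kleinSet : Finset (Perm (Fin 4)) := {1, kα, kβ, kγ}

/-- The eight `3`-cycles of `𝔖₄`, written as products of two transpositions. [folklore] -/
def threeCycleSet : Finset (Perm (Fin 4)) :=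
  {swap 1 2 * swap 1 3, swap 1 3 * swap 1 2, swap 0 2 * swap 0 3, swap 0 3 * swap 0 2,
   swap 0 1 * swap 0 3, swap 0 3 * swap 0 1, swap 0 1 * swap 0 2, swap 0 2 * swap 0 1}

/-- The alternating group `𝔄₄` as a finite set: the Klein four-group and the eight `3`-cycles.
[folklore] -/
def altSet : Finset (Perm (Fin 4)) := kleinSet ∪ threeCycleSet

/-- `V` is closed under multiplication. [folklore] -/
theorem kleinSet_mul_mem : ∀ g ∈ kleinSet, ∀ h ∈ kleinSet, g * h ∈ kleinSet := by
  unfold kleinSet kα kβ kγ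
  decide

/-- `𝔄₄` is closed under multiplication. [folklore] -/
theorem altSet_mul_mem : ∀ g ∈ altSet, ∀ h ∈ altSet, g * h ∈ altSet := by
  unfold altSet kleinSet threeCycleSet kα kβ kγ
  decide

/-- `|V| = 4`. [folklore] -/
theorem card_kleinSet : kleinSet.card = 4 := by
  unfold kleinSet kα kβ kγ
  decide

/-- `|𝔄₄| = 12`. [folklore] -/
theorem card_altSet : altSet.card = 12 := by
  unfold altSet kleinSet threeCycleSet kα kβ kγ
  decide

/-- `V ⊆ 𝔄₄`. [folklore] -/
theorem kleinSet_subset_altSet : kleinSet ⊆ altSet := Finset.subset_union_left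

/-- `V` and the `3`-cycles are disjoint. [folklore] -/
theorem disjoint_kleinSet_threeCycleSet : Disjoint kleinSet threeCycleSet := by
  unfold kleinSet threeCycleSet kα kβ kγ
  decide

/-- `𝟙_V ∈ ℂ[𝔖₄]`, the sum over the Klein four-group (CLR: the matrix `D = diag(E₄,E₄,E₄)` of
(A4) up to the coset identification). [cite: CaputoLiggettRichthammer2010, §3.2 (A4)] -/
def D4 : MonoidAlgebra ℂ (Perm (Fin 4)) := setSum kleinSet

/-- `𝟙_{𝔄₄} ∈ ℂ[𝔖₄]` (CLR: the all-ones matrix `E₁₂` of (A4)). [cite: CaputoLiggettRichthammer2010, §3.2 (A4)] -/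
def E4 : MonoidAlgebra ℂ (Perm (Fin 4)) := setSum altSet

/-- **CLR's matrix `A = A^{{0,1,2,3}}(4)` as an element of `ℂ[𝔖₄]`**: `A = 3·𝟙_V − 𝟙_{𝔄₄}`,
i.e. coefficient `2` on the identity and on the three double transpositions and `−1` on the eight
`3`-cycles (CLR (defmat) and (A4): "`A = 3 diag(E₄, E₄, E₄) − E₁₂`").
[cite: CaputoLiggettRichthammer2010, §3.2 (defmat), (A4)] -/
def A4 : MonoidAlgebra ℂ (Perm (Fin 4)) := (3 : ℂ) • D4 - E4

/-- `𝟙_V² = 4 𝟙_V`. [cite: CaputoLiggettRichthammer2010, §3.2 Lemma 3.2 (proof)] -/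
theorem D4_mul_D4 : D4 * D4 = (4 : ℂ) • D4 := by
  rw [D4, setSum_mul_setSum kleinSet_mul_mem, card_kleinSet]
  norm_num

/-- `𝟙_{𝔄₄}² = 12 𝟙_{𝔄₄}`. [cite: CaputoLiggettRichthammer2010, §3.2 Lemma 3.2 (proof)] -/
theorem E4_mul_E4 : E4 * E4 = (12 : ℂ) • E4 := by
  rw [E4, setSum_mul_setSum altSet_mul_mem, card_altSet]
  norm_num

/-- `𝟙_V 𝟙_{𝔄₄} = 4 𝟙_{𝔄₄}`. [cite: CaputoLiggettRichthammer2010, §3.2 Lemma 3.2 (proof)] -/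
theorem D4_mul_E4 : D4 * E4 = (4 : ℂ) • E4 := by
  rw [D4, E4, setSum_mul_setSum_of_subset altSet_mul_mem kleinSet_subset_altSet, card_kleinSet]
  norm_num

/-- `𝟙_{𝔄₄} 𝟙_V = 4 𝟙_{𝔄₄}`. [cite: CaputoLiggettRichthammer2010, §3.2 Lemma 3.2 (proof)] -/
theorem E4_mul_D4 : E4 * D4 = (4 : ℂ) • E4 := by
  rw [D4, E4, setSum_mul_setSum_of_subset' altSet_mul_mem kleinSet_subset_altSet, card_kleinSet]
  norm_num

/-- **`A² = 12 A`** (CLR Lemma 3.2: "`A` has the eigenvalues `0` (multiplicity 10) and `12`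
(multiplicity 2)"; here from `𝟙_V² = 4𝟙_V`, `𝟙_{𝔄₄}² = 12𝟙_{𝔄₄}`, `𝟙_V𝟙_{𝔄₄} = 𝟙_{𝔄₄}𝟙_V = 4𝟙_{𝔄₄}`).
[cite: CaputoLiggettRichthammer2010, §3.2 Lemma 3.2] -/
theorem A4_mul_A4 : A4 * A4 = (12 : ℂ) • A4 := by
  simp only [A4, sub_mul, mul_sub, smul_mul_assoc, mul_smul_comm, D4_mul_D4, E4_mul_E4, D4_mul_E4,
    E4_mul_D4, smul_sub, smul_smul]
  module

/-- `V` is closed under inversion (every element is an involution). [folklore] -/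
theorem inv_mem_kleinSet : ∀ g ∈ kleinSet, g⁻¹ ∈ kleinSet := by
  unfold kleinSet kα kβ kγ
  decide

/-- `𝔄₄` is closed under inversion. [folklore] -/
theorem inv_mem_altSet : ∀ g ∈ altSet, g⁻¹ ∈ altSet := by
  unfold altSet kleinSet threeCycleSet kα kβ kγ
  decide

/-- `V` is normal in `𝔖₄`. [folklore] -/
theorem image_conj_kleinSet (π : Perm (Fin 4)) :
    kleinSet.image (fun g => π * g * π⁻¹) = kleinSet := by
  revert π
  unfold kleinSet kα kβ kγ
  decide

/-- `𝔄₄` is normal in `𝔖₄`. [folklore] -/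
theorem image_conj_altSet (π : Perm (Fin 4)) :
    altSet.image (fun g => π * g * π⁻¹) = altSet := by
  revert π
  unfold altSet kleinSet threeCycleSet kα kβ kγ
  decide

end S4

/-! ### Transport to `ℂ[𝔖ₙ]` along an embedding `Fin k ↪ Fin n` -/

section Transport

variable {k n : ℕ}

/-- The algebra map `ℂ[𝔖_k] → ℂ[𝔖ₙ]` induced by an embedding `ι : Fin k ↪ Fin n` (permute the
image of `ι` accordingly, fix the rest: Mathlib's `Equiv.Perm.viaEmbeddingHom`). This is CLR's
identification "if `J` is identified with `{0,1,2,3}`" of §3.2. [cite: CaputoLiggettRichthammer2010, §3.2 Lemma 3.2 (proof)] -/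
def embAlg (ι : Fin k ↪ Fin n) : MonoidAlgebra ℂ (Perm (Fin k)) →ₐ[ℂ] MonoidAlgebra ℂ (Perm (Fin n)) :=
  MonoidAlgebra.mapDomainAlgHom ℂ ℂ (Perm.viaEmbeddingHom ι)

/-- `embAlg ι` on a group element. [folklore] -/
theorem embAlg_of (ι : Fin k ↪ Fin n) (g : Perm (Fin k)) :
    embAlg ι (MonoidAlgebra.of ℂ _ g) = MonoidAlgebra.of ℂ _ (Perm.viaEmbeddingHom ι g) := by
  rw [embAlg, MonoidAlgebra.mapDomainAlgHom_apply, MonoidAlgebra.of_apply,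
    MonoidAlgebra.mapDomain_single, MonoidAlgebra.of_apply]

/-- `embAlg ι 𝟙_S = 𝟙_{ι_* S}`. [folklore] -/
theorem embAlg_setSum (ι : Fin k ↪ Fin n) (S : Finset (Perm (Fin k))) :
    embAlg ι (setSum S) = setSum (S.image (Perm.viaEmbeddingHom ι)) :=
  mapDomain_setSum _ S (Perm.viaEmbeddingHom_injective ι).injOn

/-- A transposition is transported to a transposition: `ι_* (a b) = (ι a  ι b)`. [folklore] -/
theorem viaEmbeddingHom_swap (ι : Fin k ↪ Fin n) (a b : Fin k) :
    Perm.viaEmbeddingHom ι (swap a b) = swap (ι a) (ι b) := by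
  ext x
  simp only [Perm.viaEmbeddingHom_apply]
  by_cases hx : x ∈ Set.range ι
  · obtain ⟨y, rfl⟩ := hx
    rw [Perm.viaEmbedding_apply, swap_apply_def, swap_apply_def]
    simp only [EmbeddingLike.apply_eq_iff_eq]
    split_ifs <;> rfl
  · rw [Perm.viaEmbedding_apply_of_notMem _ _ _ hx, swap_apply_of_ne_of_ne]
    · rintro rfl; exact hx ⟨a, rfl⟩
    · rintro rfl; exact hx ⟨b, rfl⟩

/-- `embAlg` of a transposition. [folklore] -/
theorem embAlg_of_swap (ι : Fin k ↪ Fin n) (a b : Fin k) :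
    embAlg ι (MonoidAlgebra.of ℂ _ (swap a b)) = MonoidAlgebra.of ℂ _ (swap (ι a) (ι b)) := by
  rw [embAlg_of, viaEmbeddingHom_swap]

/-- `embAlg` of a product of two transpositions. [folklore] -/
theorem embAlg_of_swap_mul_swap (ι : Fin k ↪ Fin n) (a b c d : Fin k) :
    embAlg ι (MonoidAlgebra.of ℂ _ (swap a b * swap c d)) =
      MonoidAlgebra.of ℂ _ (swap (ι a) (ι b) * swap (ι c) (ι d)) := by
  rw [embAlg_of, map_mul, viaEmbeddingHom_swap, viaEmbeddingHom_swap]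

/-- Two embeddings with the same image differ by a permutation of the source. [folklore] -/
theorem exists_perm_of_range_eq {ι ι' : Fin k ↪ Fin n} (h : Set.range ι = Set.range ι') :
    ∃ π : Perm (Fin k), ∀ a, ι (π a) = ι' a := by
  refine ⟨ι'.toEquivRange.trans ((Equiv.setCongr h.symm).trans ι.toEquivRange.symm), fun a => ?_⟩
  simp only [Equiv.trans_apply]
  set x : Set.range ι := Equiv.setCongr h.symm (ι'.toEquivRange a) with hx
  have hxv : (x : Fin n) = ι' a := by rw [hx]; rfl
  have := ι.toEquivRange.apply_symm_apply x
  rw [Function.Embedding.toEquivRange_apply, Subtype.ext_iff] at this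
  rw [← hxv, ← this]

/-- Changing the embedding by a permutation of the source conjugates the transported
permutation: `(ι ∘ π)_* g = ι_* (π g π⁻¹)`. [folklore] -/
theorem viaEmbeddingHom_of_comp {ι ι' : Fin k ↪ Fin n} {π : Perm (Fin k)} (hπ : ∀ a, ι (π a) = ι' a)
    (g : Perm (Fin k)) :
    Perm.viaEmbeddingHom ι' g = Perm.viaEmbeddingHom ι (π * g * π⁻¹) := by
  have hrange : Set.range ι' = Set.range ι := by
    ext x
    constructor
    · rintro ⟨a, rfl⟩
      exact ⟨π a, hπ a⟩
    · rintro ⟨a, rfl⟩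
      exact ⟨π⁻¹ a, by rw [← hπ]; simp⟩
  ext x
  simp only [Perm.viaEmbeddingHom_apply]
  by_cases hx : x ∈ Set.range ι'
  · obtain ⟨a, rfl⟩ := hx
    rw [Perm.viaEmbedding_apply]
    conv_rhs => rw [← hπ a, Perm.viaEmbedding_apply]
    rw [← hπ]
    simp [Perm.mul_apply]
  · rw [Perm.viaEmbedding_apply_of_notMem _ _ _ hx,
      Perm.viaEmbedding_apply_of_notMem _ _ _ (by rwa [← hrange])]

/-- Transport of `𝟙_S` for a conjugation-invariant `S ⊆ 𝔖_k` depends only on the image of the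
embedding. [folklore] -/
theorem embAlg_setSum_eq_of_range_eq {ι ι' : Fin k ↪ Fin n} (h : Set.range ι = Set.range ι')
    {S : Finset (Perm (Fin k))} (hS : ∀ π : Perm (Fin k), S.image (fun g => π * g * π⁻¹) = S) :
    embAlg ι' (setSum S) = embAlg ι (setSum S) := by
  obtain ⟨π, hπ⟩ := exists_perm_of_range_eq h
  conv_rhs => rw [← hS π]
  rw [setSum, setSum, map_sum, map_sum, Finset.sum_image]
  · refine Finset.sum_congr rfl fun g _ => ?_
    rw [embAlg_of, embAlg_of, viaEmbeddingHom_of_comp hπ]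
  · intro g _ g' _ hgg'
    simpa using hgg'

/-- **CLR's `A^J(n) ∈ ℂ[𝔖ₙ]`** for the `4`-set `J = ι(Fin 4)`: the transport of `A = 3𝟙_V − 𝟙_{𝔄₄}`,
i.e. `2` on the identity and the three double transpositions of `J`, `−1` on the eight `3`-cycles
of `J` (CLR (defmat)); it depends only on `J` (`octA_eq_of_range_eq`).
[cite: CaputoLiggettRichthammer2010, §3.2 (defmat)] -/
def octA (ι : Fin 4 ↪ Fin n) : MonoidAlgebra ℂ (Perm (Fin n)) := embAlg ι A4

/-- Unfolding: `A^J = 3·𝟙_{ι_*V} − 𝟙_{ι_*𝔄₄}`. [cite: CaputoLiggettRichthammer2010, §3.2 (A4)] -/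
theorem octA_eq (ι : Fin 4 ↪ Fin n) :
    octA ι = (3 : ℂ) • setSum (kleinSet.image (Perm.viaEmbeddingHom ι)) -
      setSum (altSet.image (Perm.viaEmbeddingHom ι)) := by
  rw [octA, A4, map_sub, map_smul, D4, E4, embAlg_setSum, embAlg_setSum]

/-- `A^J` depends only on the set `J`, not on its enumeration (CLR: "`A^J_{η,η'}(n)` only depends
on `η⁻¹η'`" and the definition (defmat) is in terms of cycle types within `J`).
[cite: CaputoLiggettRichthammer2010, §3.2 Lemma 3.2 (proof)] -/
theorem octA_eq_of_range_eq {ι ι' : Fin 4 ↪ Fin n} (h : Set.range ι = Set.range ι') :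
    octA ι = octA ι' := by
  rw [octA, octA, A4, map_sub, map_sub, map_smul, map_smul, D4, E4,
    embAlg_setSum_eq_of_range_eq h image_conj_kleinSet,
    embAlg_setSum_eq_of_range_eq h image_conj_altSet]

/-- **`(A^J)² = 12 A^J`** in `ℂ[𝔖ₙ]` (CLR Lemma 3.2 via the block structure: "all diagonal blocks
of `A^J(n)` are copies of `A`"). [cite: CaputoLiggettRichthammer2010, §3.2 Lemma 3.2] -/
theorem octA_mul_octA (ι : Fin 4 ↪ Fin n) : octA ι * octA ι = (12 : ℂ) • octA ι := by
  rw [octA, ← map_mul, A4_mul_A4, map_smul]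

end Transport

/-! ### The left regular action of `ℂ[𝔖ₙ]` on `ℓ²(𝔖ₙ)`: adjoints and positivity -/

section RegOp

variable {n : ℕ}

/-- The action of `ℂ[𝔖ₙ]` on functions `𝔖ₙ → ℂ` through the left regular representation
`permLeftRegular n` of `AldousLambdaOne.lean` (`(λ(g)f)(τ) = f(g⁻¹τ)`): CLR's matrices indexed
by permutations, acting on `ℓ²(𝒳ₙ)`. [cite: CaputoLiggettRichthammer2010, §3 (defC)] -/
def regOp (n : ℕ) : MonoidAlgebra ℂ (Perm (Fin n)) →ₐ[ℂ] Module.End ℂ (Perm (Fin n) → ℂ) :=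
  (permLeftRegular n).asAlgebraHom

/-- `regOp` of a group element is the left shift by its inverse. [folklore] -/
theorem regOp_of_apply (g : Perm (Fin n)) (f : Perm (Fin n) → ℂ) (τ : Perm (Fin n)) :
    regOp n (MonoidAlgebra.of ℂ _ g) f τ = f (g⁻¹ * τ) := by
  rw [regOp, Representation.asAlgebraHom_of, permLeftRegular_apply]

/-- `regOp` of a transposition: `(λ((uv)) f)(τ) = f((uv)τ)`. [folklore] -/
theorem regOp_of_swap_apply (u v : Fin n) (f : Perm (Fin n) → ℂ) (τ : Perm (Fin n)) :
    regOp n (MonoidAlgebra.of ℂ _ (swap u v)) f τ = f (swap u v * τ) := by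
  rw [regOp_of_apply, swap_inv]

/-- `regOp 𝟙_S f = ∑_{g ∈ S} f(g⁻¹ ·)`. [folklore] -/
theorem regOp_setSum_apply (S : Finset (Perm (Fin n))) (f : Perm (Fin n) → ℂ) (τ : Perm (Fin n)) :
    regOp n (setSum S) f τ = ∑ g ∈ S, f (g⁻¹ * τ) := by
  rw [setSum, map_sum, LinearMap.sum_apply, Finset.sum_apply]
  exact Finset.sum_congr rfl fun g _ => regOp_of_apply g f τ

/-- **`λ(𝟙_S)` is self-adjoint for an inversion-closed `S`**: `⟪f, λ(𝟙_S) h⟫ = ⟪λ(𝟙_S) f, h⟫`.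
[folklore] -/
theorem l2Inner_regOp_setSum_comm {S : Finset (Perm (Fin n))} (hS : ∀ g ∈ S, g⁻¹ ∈ S)
    (f h : Perm (Fin n) → ℂ) :
    l2Inner f (regOp n (setSum S) h) = l2Inner (regOp n (setSum S) f) h := by
  have hL : (regOp n (setSum S) h : Perm (Fin n) → ℂ) = ∑ g ∈ S, fun τ => h (g⁻¹ * τ) := by
    funext τ
    rw [regOp_setSum_apply, Finset.sum_apply]
  have hR : (regOp n (setSum S) f : Perm (Fin n) → ℂ) = ∑ g ∈ S, fun τ => f (g⁻¹ * τ) := by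
    funext τ
    rw [regOp_setSum_apply, Finset.sum_apply]
  rw [hL, hR, l2Inner_sum_right, l2Inner_sum_left]
  -- reindex the right-hand sum by `g ↦ g⁻¹`
  refine Finset.sum_nbij (fun g => g⁻¹) (fun g hg => hS g hg) ?_ ?_ ?_
  · intro g _ g' _ hgg'
    exact inv_injective hgg'
  · intro g hg
    exact ⟨g⁻¹, hS g hg, inv_inv g⟩
  · intro g _
    rw [l2Inner_shift_right, inv_inv]

/-- Inversion-closedness is preserved by group homomorphisms. [folklore] -/
theorem inv_mem_image {k : ℕ} {S : Finset (Perm (Fin k))} (hS : ∀ g ∈ S, g⁻¹ ∈ S)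
    (φ : Perm (Fin k) →* Perm (Fin n)) : ∀ g ∈ S.image φ, g⁻¹ ∈ S.image φ := by
  intro g hg
  obtain ⟨g', hg', rfl⟩ := Finset.mem_image.mp hg
  exact Finset.mem_image.mpr ⟨g'⁻¹, hS g' hg', map_inv φ g'⟩

/-- **`λ(A^J)` is self-adjoint.** [cite: CaputoLiggettRichthammer2010, §3.2 Lemma 3.2] -/
theorem l2Inner_regOp_octA_comm (ι : Fin 4 ↪ Fin n) (f h : Perm (Fin n) → ℂ) :
    l2Inner f (regOp n (octA ι) h) = l2Inner (regOp n (octA ι) f) h := by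
  rw [octA_eq, map_sub, map_smul, LinearMap.sub_apply, LinearMap.smul_apply, LinearMap.sub_apply,
    LinearMap.smul_apply, l2Inner_sub_right, l2Inner_sub_left, l2Inner_smul_right, l2Inner_smul_left,
    l2Inner_regOp_setSum_comm (inv_mem_image inv_mem_kleinSet _),
    l2Inner_regOp_setSum_comm (inv_mem_image inv_mem_altSet _), map_ofNat]

/-- A self-adjoint operator `X` with `X² = c X`, `c > 0`, is non-negative:
`Re⟪f, X f⟫ = ‖X f‖²/c ≥ 0` (CLR §3.1: "`A ≥ 0` … if `A − B` is positive semi-definite").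
[cite: CaputoLiggettRichthammer2010, §3.1] -/
theorem re_l2Inner_nonneg_of_sq {Ω : Type*} [Fintype Ω] (X : Module.End ℂ (Ω → ℂ)) {c : ℝ}
    (hc : 0 < c) (hX : X * X = (c : ℂ) • X)
    (hsymm : ∀ f h : Ω → ℂ, l2Inner f (X h) = l2Inner (X f) h) (f : Ω → ℂ) :
    0 ≤ (l2Inner f (X f)).re := by
  have h1 : (c : ℂ) * l2Inner f (X f) = l2Inner (X f) (X f) := by
    rw [← l2Inner_smul_right, ← LinearMap.smul_apply, ← hX, Module.End.mul_apply, hsymm]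
  have h2 : c * (l2Inner f (X f)).re = l2NormSq (X f) := by
    have := congrArg Complex.re h1
    rwa [Complex.re_ofReal_mul, l2Inner_self_re] at this
  have h3 : 0 ≤ c * (l2Inner f (X f)).re := h2 ▸ l2NormSq_nonneg _
  exact (mul_nonneg_iff_of_pos_left hc).mp h3

/-- **CLR Lemma 3.2: `A^J(n) ≥ 0`.** [cite: CaputoLiggettRichthammer2010, §3.2 Lemma 3.2] -/
theorem re_l2Inner_regOp_octA_nonneg (ι : Fin 4 ↪ Fin n) (f : Perm (Fin n) → ℂ) :
    0 ≤ (l2Inner f (regOp n (octA ι) f)).re := by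
  refine re_l2Inner_nonneg_of_sq _ (by norm_num : (0 : ℝ) < 12) ?_ (l2Inner_regOp_octA_comm ι) f
  rw [← map_mul, octA_mul_octA, map_smul]
  norm_num

end RegOp

/-! ### The concrete layer in `ℂ[𝔖₅]`: CLR's `B = A⁽¹⁾ + A⁽²⁾ + A⁽³⁾ + A⁽⁴⁾ − A⁽⁰⁾` -/

section S5

/-- Expansion of `𝟙_V` into its four terms. [folklore] -/
theorem D4_expand : D4 = 1 + MonoidAlgebra.of ℂ _ kα + MonoidAlgebra.of ℂ _ kβ + MonoidAlgebra.of ℂ _ kγ := by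
  rw [D4, setSum, kleinSet, Finset.sum_insert (by unfold kα kβ kγ; decide),
    Finset.sum_insert (by unfold kα kβ kγ; decide), Finset.sum_insert (by unfold kβ kγ; decide),
    Finset.sum_singleton, map_one]
  abel

/-- Expansion of the sum over the eight `3`-cycles of `𝔖₄`. [folklore] -/
theorem setSum_threeCycleSet :
    setSum threeCycleSet =
      MonoidAlgebra.of ℂ _ (swap 1 2 * swap 1 3) + MonoidAlgebra.of ℂ _ (swap 1 3 * swap 1 2) +
      MonoidAlgebra.of ℂ _ (swap 0 2 * swap 0 3) + MonoidAlgebra.of ℂ _ (swap 0 3 * swap 0 2) +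
      MonoidAlgebra.of ℂ _ (swap 0 1 * swap 0 3) + MonoidAlgebra.of ℂ _ (swap 0 3 * swap 0 1) +
      MonoidAlgebra.of ℂ _ (swap 0 1 * swap 0 2) + MonoidAlgebra.of ℂ _ (swap 0 2 * swap 0 1) := by
  rw [setSum, threeCycleSet, Finset.sum_insert (by decide), Finset.sum_insert (by decide),
    Finset.sum_insert (by decide), Finset.sum_insert (by decide), Finset.sum_insert (by decide),
    Finset.sum_insert (by decide), Finset.sum_insert (by decide), Finset.sum_singleton]
  abel

/-- `𝟙_{𝔄₄} = 𝟙_V + (sum of the eight 3-cycles)`. [folklore] -/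
theorem E4_expand : E4 = D4 + setSum threeCycleSet := by
  rw [E4, D4, altSet, setSum, setSum, setSum, Finset.sum_union disjoint_kleinSet_threeCycleSet]

/-- The face embeddings `Fin 4 ↪ Fin 5` omitting `i` (increasing). [folklore] -/
def faceEmb (i : Fin 5) : Fin 4 ↪ Fin 5 := Fin.succAboveEmb i

/-- Values of the face embeddings. [folklore] -/
theorem faceEmb_apply (i : Fin 5) (a : Fin 4) : faceEmb i a = Fin.succAbove i a := rfl

/-- **CLR's `A⁽ⁱ⁾ := A^{{0,1,2,3,4}∖{i}}(5) ∈ ℂ[𝔖₅]`.** [cite: CaputoLiggettRichthammer2010, §3.2 (before Lemma 3.2)] -/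
def Aface (i : Fin 5) : MonoidAlgebra ℂ (Perm (Fin 5)) := octA (faceEmb i)

/-- **CLR's `B := A⁽¹⁾ + A⁽²⁾ + A⁽³⁾ + A⁽⁴⁾ − A⁽⁰⁾ = B⁺ − 2A⁽⁰⁾`.**
[cite: CaputoLiggettRichthammer2010, §3.2 Lemma 3.3] -/
def B5 : MonoidAlgebra ℂ (Perm (Fin 5)) := (∑ i : Fin 5, Aface i) - (2 : ℂ) • Aface 0

local notation "𝐨" => MonoidAlgebra.of ℂ (Perm (Fin 5))

/-- `𝟙_{V₀}`: the Klein four-group of `{1,2,3,4}`. [cite: CaputoLiggettRichthammer2010, §3.2 Lemma 3.3 (proof)] -/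
def D₀ : MonoidAlgebra ℂ (Perm (Fin 5)) := setSum (kleinSet.image (Perm.viaEmbeddingHom (faceEmb 0)))

/-- `𝟙_{𝔄₄⁽⁰⁾}`: the alternating group of `{1,2,3,4}`. [cite: CaputoLiggettRichthammer2010, §3.2 Lemma 3.3 (proof)] -/
def E₀ : MonoidAlgebra ℂ (Perm (Fin 5)) := setSum (altSet.image (Perm.viaEmbeddingHom (faceEmb 0)))

/-- `A⁽⁰⁾ = 3𝟙_{V₀} − 𝟙_{𝔄₄⁽⁰⁾}`. [cite: CaputoLiggettRichthammer2010, §3.2] -/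
theorem Aface_zero_eq : Aface 0 = (3 : ℂ) • D₀ - E₀ := octA_eq _

/-- The six transpositions of `{1,2,3,4} ⊂ Fin 5`. [folklore] -/
def T₀ : MonoidAlgebra ℂ (Perm (Fin 5)) :=
  𝐨 (swap 1 2) + 𝐨 (swap 1 3) + 𝐨 (swap 1 4) + 𝐨 (swap 2 3) + 𝐨 (swap 2 4) + 𝐨 (swap 3 4)

/-- The transpositions of `{1,2,3,4}` through `1`. [folklore] -/
def U₁ : MonoidAlgebra ℂ (Perm (Fin 5)) := 𝐨 (swap 1 2) + 𝐨 (swap 1 3) + 𝐨 (swap 1 4)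
/-- The transpositions of `{1,2,3,4}` through `2`. [folklore] -/
def U₂ : MonoidAlgebra ℂ (Perm (Fin 5)) := 𝐨 (swap 1 2) + 𝐨 (swap 2 3) + 𝐨 (swap 2 4)
/-- The transpositions of `{1,2,3,4}` through `3`. [folklore] -/
def U₃ : MonoidAlgebra ℂ (Perm (Fin 5)) := 𝐨 (swap 1 3) + 𝐨 (swap 2 3) + 𝐨 (swap 3 4)
/-- The transpositions of `{1,2,3,4}` through `4`. [folklore] -/
def U₄ : MonoidAlgebra ℂ (Perm (Fin 5)) := 𝐨 (swap 1 4) + 𝐨 (swap 2 4) + 𝐨 (swap 3 4)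

/-- `Yd = ∑_a (0 a) · (T − 2 U_a)` (the difference "double transpositions through `0`" minus
"`3`-cycles through `0`", organised tentacle by tentacle). [folklore] -/
def Yd : MonoidAlgebra ℂ (Perm (Fin 5)) :=
  𝐨 (swap 0 1) * (T₀ - (2 : ℂ) • U₁) + 𝐨 (swap 0 2) * (T₀ - (2 : ℂ) • U₂) +
  𝐨 (swap 0 3) * (T₀ - (2 : ℂ) • U₃) + 𝐨 (swap 0 4) * (T₀ - (2 : ℂ) • U₄)

/-- The mirror image `Yd' = ∑_a (T − 2 U_a) · (0 a)`. [folklore] -/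
def Yd' : MonoidAlgebra ℂ (Perm (Fin 5)) :=
  (T₀ - (2 : ℂ) • U₁) * 𝐨 (swap 0 1) + (T₀ - (2 : ℂ) • U₂) * 𝐨 (swap 0 2) +
  (T₀ - (2 : ℂ) • U₃) * 𝐨 (swap 0 3) + (T₀ - (2 : ℂ) • U₄) * 𝐨 (swap 0 4)

/-- Expansion of `A⁽ⁱ⁾` in words of transpositions. [cite: CaputoLiggettRichthammer2010, §3.2 (defmat)] -/
theorem Aface_expand (i : Fin 5) :
    Aface i = (3 : ℂ) • (1 + 𝐨 (swap (faceEmb i 0) (faceEmb i 1) * swap (faceEmb i 2) (faceEmb i 3)) +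
        𝐨 (swap (faceEmb i 0) (faceEmb i 2) * swap (faceEmb i 1) (faceEmb i 3)) +
        𝐨 (swap (faceEmb i 0) (faceEmb i 3) * swap (faceEmb i 1) (faceEmb i 2))) -
      ((1 + 𝐨 (swap (faceEmb i 0) (faceEmb i 1) * swap (faceEmb i 2) (faceEmb i 3)) +
        𝐨 (swap (faceEmb i 0) (faceEmb i 2) * swap (faceEmb i 1) (faceEmb i 3)) +
        𝐨 (swap (faceEmb i 0) (faceEmb i 3) * swap (faceEmb i 1) (faceEmb i 2))) +
      (𝐨 (swap (faceEmb i 1) (faceEmb i 2) * swap (faceEmb i 1) (faceEmb i 3)) +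
        𝐨 (swap (faceEmb i 1) (faceEmb i 3) * swap (faceEmb i 1) (faceEmb i 2)) +
        𝐨 (swap (faceEmb i 0) (faceEmb i 2) * swap (faceEmb i 0) (faceEmb i 3)) +
        𝐨 (swap (faceEmb i 0) (faceEmb i 3) * swap (faceEmb i 0) (faceEmb i 2)) +
        𝐨 (swap (faceEmb i 0) (faceEmb i 1) * swap (faceEmb i 0) (faceEmb i 3)) +
        𝐨 (swap (faceEmb i 0) (faceEmb i 3) * swap (faceEmb i 0) (faceEmb i 1)) +
        𝐨 (swap (faceEmb i 0) (faceEmb i 1) * swap (faceEmb i 0) (faceEmb i 2)) +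
        𝐨 (swap (faceEmb i 0) (faceEmb i 2) * swap (faceEmb i 0) (faceEmb i 1)))) := by
  rw [Aface, octA, A4, E4_expand, D4_expand, setSum_threeCycleSet]
  simp only [map_sub, map_smul, map_add, map_one, kα, kβ, kγ, embAlg_of_swap_mul_swap]

/-- A value of a face embedding. [folklore] -/
theorem faceEmb_0_0 : faceEmb 0 0 = 1 := by decide
/-- A value of a face embedding. [folklore] -/
theorem faceEmb_0_1 : faceEmb 0 1 = 2 := by decide
/-- A value of a face embedding. [folklore] -/
theorem faceEmb_0_2 : faceEmb 0 2 = 3 := by decide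
/-- A value of a face embedding. [folklore] -/
theorem faceEmb_0_3 : faceEmb 0 3 = 4 := by decide
/-- A value of a face embedding. [folklore] -/
theorem faceEmb_1_0 : faceEmb 1 0 = 0 := by decide
/-- A value of a face embedding. [folklore] -/
theorem faceEmb_1_1 : faceEmb 1 1 = 2 := by decide
/-- A value of a face embedding. [folklore] -/
theorem faceEmb_1_2 : faceEmb 1 2 = 3 := by decide
/-- A value of a face embedding. [folklore] -/
theorem faceEmb_1_3 : faceEmb 1 3 = 4 := by decide
/-- A value of a face embedding. [folklore] -/
theorem faceEmb_2_0 : faceEmb 2 0 = 0 := by decide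
/-- A value of a face embedding. [folklore] -/
theorem faceEmb_2_1 : faceEmb 2 1 = 1 := by decide
/-- A value of a face embedding. [folklore] -/
theorem faceEmb_2_2 : faceEmb 2 2 = 3 := by decide
/-- A value of a face embedding. [folklore] -/
theorem faceEmb_2_3 : faceEmb 2 3 = 4 := by decide
/-- A value of a face embedding. [folklore] -/
theorem faceEmb_3_0 : faceEmb 3 0 = 0 := by decide
/-- A value of a face embedding. [folklore] -/
theorem faceEmb_3_1 : faceEmb 3 1 = 1 := by decide
/-- A value of a face embedding. [folklore] -/
theorem faceEmb_3_2 : faceEmb 3 2 = 2 := by decide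
/-- A value of a face embedding. [folklore] -/
theorem faceEmb_3_3 : faceEmb 3 3 = 4 := by decide
/-- A value of a face embedding. [folklore] -/
theorem faceEmb_4_0 : faceEmb 4 0 = 0 := by decide
/-- A value of a face embedding. [folklore] -/
theorem faceEmb_4_1 : faceEmb 4 1 = 1 := by decide
/-- A value of a face embedding. [folklore] -/
theorem faceEmb_4_2 : faceEmb 4 2 = 2 := by decide
/-- A value of a face embedding. [folklore] -/
theorem faceEmb_4_3 : faceEmb 4 3 = 3 := by decide

/-- `𝟙_{V₀}` in words. [folklore] -/
theorem D₀_expand : D₀ = 1 + 𝐨 (swap 1 2 * swap 3 4) + 𝐨 (swap 1 3 * swap 2 4) + 𝐨 (swap 1 4 * swap 2 3) := by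
  rw [D₀, ← embAlg_setSum, ← D4, D4_expand]
  simp only [map_add, map_one, kα, kβ, kγ, embAlg_of_swap_mul_swap, faceEmb_0_0, faceEmb_0_1, faceEmb_0_2, faceEmb_0_3]

/-- The twelve identities `(0 a)(a b) = (0 b)(0 a)` in `𝔖₅`. [folklore] -/
theorem swap_zero_mul_swap_eq :
    swap (0 : Fin 5) 1 * swap 1 2 = swap 0 2 * swap 0 1 ∧ swap (0 : Fin 5) 1 * swap 1 3 = swap 0 3 * swap 0 1 ∧
    swap (0 : Fin 5) 1 * swap 1 4 = swap 0 4 * swap 0 1 ∧ swap (0 : Fin 5) 2 * swap 1 2 = swap 0 1 * swap 0 2 ∧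
    swap (0 : Fin 5) 2 * swap 2 3 = swap 0 3 * swap 0 2 ∧ swap (0 : Fin 5) 2 * swap 2 4 = swap 0 4 * swap 0 2 ∧
    swap (0 : Fin 5) 3 * swap 1 3 = swap 0 1 * swap 0 3 ∧ swap (0 : Fin 5) 3 * swap 2 3 = swap 0 2 * swap 0 3 ∧
    swap (0 : Fin 5) 3 * swap 3 4 = swap 0 4 * swap 0 3 ∧ swap (0 : Fin 5) 4 * swap 1 4 = swap 0 1 * swap 0 4 ∧
    swap (0 : Fin 5) 4 * swap 2 4 = swap 0 2 * swap 0 4 ∧ swap (0 : Fin 5) 4 * swap 3 4 = swap 0 3 * swap 0 4 := by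
  decide

/-- **`B = 8 + 2 Yd − 2 𝟙_{V₀}`**: the five transported `A`'s regrouped (the `3`-cycles of
`{1,2,3,4}` cancel between `A⁽¹⁾+⋯+A⁽⁴⁾` and `A⁽⁰⁾`). [cite: CaputoLiggettRichthammer2010, §3.2 Lemma 3.3 (proof)] -/
theorem B5_eq : B5 = (8 : ℂ) • 1 + (2 : ℂ) • Yd - (2 : ℂ) • D₀ := by
  obtain ⟨h1, h2, h3, h4, h5, h6, h7, h8, h9, h10, h11, h12⟩ := swap_zero_mul_swap_eq
  rw [B5, Fin.sum_univ_five, Aface_expand, Aface_expand, Aface_expand, Aface_expand, Aface_expand,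
    D₀_expand, Yd, T₀, U₁, U₂, U₃, U₄]
  simp only [faceEmb_0_0, faceEmb_0_1, faceEmb_0_2, faceEmb_0_3, faceEmb_1_0, faceEmb_1_1, faceEmb_1_2, faceEmb_1_3, faceEmb_2_0, faceEmb_2_1, faceEmb_2_2, faceEmb_2_3, faceEmb_3_0, faceEmb_3_1, faceEmb_3_2, faceEmb_3_3, faceEmb_4_0, faceEmb_4_1, faceEmb_4_2, faceEmb_4_3, mul_sub, mul_add, smul_add, smul_sub, mul_smul_comm, ← map_mul,
    h1, h2, h3, h4, h5, h6, h7, h8, h9, h10, h11, h12]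
  module

/-- `𝟙_{V₀}` is the transport of `𝟙_V`. [folklore] -/
theorem D₀_eq_embAlg : D₀ = embAlg (faceEmb 0) D4 := by rw [D₀, D4, embAlg_setSum]

/-- `𝟙_{𝔄₄⁽⁰⁾}` is the transport of `𝟙_{𝔄₄}`. [folklore] -/
theorem E₀_eq_embAlg : E₀ = embAlg (faceEmb 0) E4 := by rw [E₀, E4, embAlg_setSum]

/-- `𝟙_{V₀}² = 4𝟙_{V₀}`. [cite: CaputoLiggettRichthammer2010, §3.2 Lemma 3.3 (proof)] -/
theorem D₀_mul_D₀ : D₀ * D₀ = (4 : ℂ) • D₀ := by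
  rw [D₀_eq_embAlg, ← map_mul, D4_mul_D4, map_smul]

/-- `𝟙_{𝔄₄⁽⁰⁾}² = 12 𝟙_{𝔄₄⁽⁰⁾}`. [cite: CaputoLiggettRichthammer2010, §3.2 Lemma 3.3 (proof)] -/
theorem E₀_mul_E₀ : E₀ * E₀ = (12 : ℂ) • E₀ := by
  rw [E₀_eq_embAlg, ← map_mul, E4_mul_E4, map_smul]

/-- `𝟙_{V₀} 𝟙_{𝔄₄⁽⁰⁾} = 4 𝟙_{𝔄₄⁽⁰⁾}`. [cite: CaputoLiggettRichthammer2010, §3.2 Lemma 3.3 (proof)] -/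
theorem D₀_mul_E₀ : D₀ * E₀ = (4 : ℂ) • E₀ := by
  rw [D₀_eq_embAlg, E₀_eq_embAlg, ← map_mul, D4_mul_E4, map_smul]

/-- `𝟙_{𝔄₄⁽⁰⁾} 𝟙_{V₀} = 4 𝟙_{𝔄₄⁽⁰⁾}`. [cite: CaputoLiggettRichthammer2010, §3.2 Lemma 3.3 (proof)] -/
theorem E₀_mul_D₀ : E₀ * D₀ = (4 : ℂ) • E₀ := by
  rw [D₀_eq_embAlg, E₀_eq_embAlg, ← map_mul, E4_mul_D4, map_smul]

/-- Images of multiplicatively closed sets under homomorphisms are multiplicatively closed. [folklore] -/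
theorem image_mul_mem {G H : Type*} [Group G] [Group H] [DecidableEq H] {S : Finset G}
    (hS : ∀ g ∈ S, ∀ h ∈ S, g * h ∈ S) (φ : G →* H) :
    ∀ g ∈ S.image φ, ∀ h ∈ S.image φ, g * h ∈ S.image φ := by
  intro g hg h hh
  obtain ⟨g', hg', rfl⟩ := Finset.mem_image.mp hg
  obtain ⟨h', hh', rfl⟩ := Finset.mem_image.mp hh
  exact Finset.mem_image.mpr ⟨g' * h', hS g' hg' h' hh', map_mul φ g' h'⟩

/-- The three Klein involutions of `{1,2,3,4}` lie in `V₀`. [folklore] -/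
theorem klein_mem_image :
    swap (1 : Fin 5) 2 * swap 3 4 ∈ kleinSet.image (Perm.viaEmbeddingHom (faceEmb 0)) ∧
    swap (1 : Fin 5) 3 * swap 2 4 ∈ kleinSet.image (Perm.viaEmbeddingHom (faceEmb 0)) ∧
    swap (1 : Fin 5) 4 * swap 2 3 ∈ kleinSet.image (Perm.viaEmbeddingHom (faceEmb 0)) := by
  refine ⟨Finset.mem_image.mpr ⟨kα, by unfold kleinSet; simp, ?_⟩,
    Finset.mem_image.mpr ⟨kβ, by unfold kleinSet; simp, ?_⟩,
    Finset.mem_image.mpr ⟨kγ, by unfold kleinSet; simp, ?_⟩⟩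
  · rw [kα, map_mul, viaEmbeddingHom_swap, viaEmbeddingHom_swap, faceEmb_0_0, faceEmb_0_1,
      faceEmb_0_2, faceEmb_0_3]
  · rw [kβ, map_mul, viaEmbeddingHom_swap, viaEmbeddingHom_swap, faceEmb_0_0, faceEmb_0_1,
      faceEmb_0_2, faceEmb_0_3]
  · rw [kγ, map_mul, viaEmbeddingHom_swap, viaEmbeddingHom_swap, faceEmb_0_0, faceEmb_0_1,
      faceEmb_0_2, faceEmb_0_3]

/-- **Absorption**: the Klein involutions of `{1,2,3,4}` are absorbed by `𝟙_{V₀}` and by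
`𝟙_{𝔄₄⁽⁰⁾}` on either side. [cite: CaputoLiggettRichthammer2010, §3.2 Lemma 3.3 (proof)] -/
theorem klein_absorb (X : MonoidAlgebra ℂ (Perm (Fin 5))) (hX : X = D₀ ∨ X = E₀) :
    (𝐨 (swap 1 2 * swap 3 4) * X = X ∧ 𝐨 (swap 1 3 * swap 2 4) * X = X ∧ 𝐨 (swap 1 4 * swap 2 3) * X = X) ∧
    (X * 𝐨 (swap 1 2 * swap 3 4) = X ∧ X * 𝐨 (swap 1 3 * swap 2 4) = X ∧ X * 𝐨 (swap 1 4 * swap 2 3) = X) := by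
  obtain ⟨m1, m2, m3⟩ := klein_mem_image
  rcases hX with rfl | rfl
  · have hc := image_mul_mem kleinSet_mul_mem (Perm.viaEmbeddingHom (faceEmb 0))
    exact ⟨⟨of_mul_setSum hc m1, of_mul_setSum hc m2, of_mul_setSum hc m3⟩,
      ⟨setSum_mul_of hc m1, setSum_mul_of hc m2, setSum_mul_of hc m3⟩⟩
  · have hc := image_mul_mem altSet_mul_mem (Perm.viaEmbeddingHom (faceEmb 0))
    have sub : kleinSet.image (Perm.viaEmbeddingHom (faceEmb 0)) ⊆
        altSet.image (Perm.viaEmbeddingHom (faceEmb 0)) := Finset.image_subset_image kleinSet_subset_altSet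
    exact ⟨⟨of_mul_setSum hc (sub m1), of_mul_setSum hc (sub m2), of_mul_setSum hc (sub m3)⟩,
      ⟨setSum_mul_of hc (sub m1), setSum_mul_of hc (sub m2), setSum_mul_of hc (sub m3)⟩⟩

/-- The tentacle relations: from absorption of the Klein involutions, opposite transpositions of
`{1,2,3,4}` act alike on `X ∈ {𝟙_{V₀}, 𝟙_{𝔄₄⁽⁰⁾}}` (CLR: "two permutations from the same coset
`ηH` differ by an element of `H`"). [cite: CaputoLiggettRichthammer2010, §3.2 Lemma 3.3 (proof)] -/
theorem swap_rel (X : MonoidAlgebra ℂ (Perm (Fin 5))) (hX : X = D₀ ∨ X = E₀) :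
    (𝐨 (swap 3 4) * X = 𝐨 (swap 1 2) * X ∧ 𝐨 (swap 2 4) * X = 𝐨 (swap 1 3) * X ∧
      𝐨 (swap 2 3) * X = 𝐨 (swap 1 4) * X) ∧
    (X * 𝐨 (swap 3 4) = X * 𝐨 (swap 1 2) ∧ X * 𝐨 (swap 2 4) = X * 𝐨 (swap 1 3) ∧
      X * 𝐨 (swap 2 3) = X * 𝐨 (swap 1 4)) := by
  obtain ⟨⟨l1, l2, l3⟩, ⟨r1, r2, r3⟩⟩ := klein_absorb X hX
  have e1 : swap (3 : Fin 5) 4 = swap 1 2 * (swap 1 2 * swap 3 4) := by decide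
  have e2 : swap (2 : Fin 5) 4 = swap 1 3 * (swap 1 3 * swap 2 4) := by decide
  have e3 : swap (2 : Fin 5) 3 = swap 1 4 * (swap 1 4 * swap 2 3) := by decide
  have f1 : swap (3 : Fin 5) 4 = (swap 1 2 * swap 3 4) * swap 1 2 := by decide
  have f2 : swap (2 : Fin 5) 4 = (swap 1 3 * swap 2 4) * swap 1 3 := by decide
  have f3 : swap (2 : Fin 5) 3 = (swap 1 4 * swap 2 3) * swap 1 4 := by decide
  refine ⟨⟨?_, ?_, ?_⟩, ⟨?_, ?_, ?_⟩⟩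
  · conv_lhs => rw [e1, map_mul, mul_assoc, l1]
  · conv_lhs => rw [e2, map_mul, mul_assoc, l2]
  · conv_lhs => rw [e3, map_mul, mul_assoc, l3]
  · conv_lhs => rw [f1, map_mul, ← mul_assoc, r1]
  · conv_lhs => rw [f2, map_mul, ← mul_assoc, r2]
  · conv_lhs => rw [f3, map_mul, ← mul_assoc, r3]

/-- **The tentacles annihilate `𝟙_{V₀}` and `𝟙_{𝔄₄⁽⁰⁾}`**: `(T − 2U_a) X = 0 = X (T − 2U_a)`.
[cite: CaputoLiggettRichthammer2010, §3.2 Lemma 3.3 (proof of (B5))] -/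
theorem tentacle_mul_eq_zero (X : MonoidAlgebra ℂ (Perm (Fin 5))) (hX : X = D₀ ∨ X = E₀) :
    ((T₀ - (2 : ℂ) • U₁) * X = 0 ∧ (T₀ - (2 : ℂ) • U₂) * X = 0 ∧ (T₀ - (2 : ℂ) • U₃) * X = 0 ∧
      (T₀ - (2 : ℂ) • U₄) * X = 0) ∧
    (X * (T₀ - (2 : ℂ) • U₁) = 0 ∧ X * (T₀ - (2 : ℂ) • U₂) = 0 ∧ X * (T₀ - (2 : ℂ) • U₃) = 0 ∧
      X * (T₀ - (2 : ℂ) • U₄) = 0) := by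
  obtain ⟨⟨l1, l2, l3⟩, ⟨r1, r2, r3⟩⟩ := swap_rel X hX
  refine ⟨⟨?_, ?_, ?_, ?_⟩, ⟨?_, ?_, ?_, ?_⟩⟩ <;>
  · simp only [T₀, U₁, U₂, U₃, U₄, sub_mul, add_mul, mul_sub, mul_add, smul_mul_assoc, mul_smul_comm,
      l1, l2, l3, r1, r2, r3, smul_add]
    module

/-- `Yd X = 0` and `X Yd' = 0` for `X ∈ {𝟙_{V₀}, 𝟙_{𝔄₄⁽⁰⁾}}`. [cite: CaputoLiggettRichthammer2010, §3.2 Lemma 3.3 (proof of (B5))] -/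
theorem Yd_mul_eq_zero (X : MonoidAlgebra ℂ (Perm (Fin 5))) (hX : X = D₀ ∨ X = E₀) :
    Yd * X = 0 ∧ X * Yd' = 0 := by
  obtain ⟨⟨l1, l2, l3, l4⟩, ⟨r1, r2, r3, r4⟩⟩ := tentacle_mul_eq_zero X hX
  constructor
  · simp only [Yd, add_mul, mul_assoc, l1, l2, l3, l4, mul_zero, add_zero]
  · simp only [Yd', mul_add, ← mul_assoc, r1, r2, r3, r4, zero_mul, add_zero]

/-- The commutations needed for the mirror form of `Yd`: `(0a)(bc) = (bc)(0a)` for `a ∉ {b,c}` and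
`(ab)(0a) = (0a)(0b)`. [folklore] -/
theorem swap_mul_swap_zero_eq :
    (swap (2 : Fin 5) 3 * swap 0 1 = swap 0 1 * swap 2 3 ∧ swap (2 : Fin 5) 4 * swap 0 1 = swap 0 1 * swap 2 4 ∧
    swap (3 : Fin 5) 4 * swap 0 1 = swap 0 1 * swap 3 4 ∧ swap (1 : Fin 5) 3 * swap 0 2 = swap 0 2 * swap 1 3 ∧
    swap (1 : Fin 5) 4 * swap 0 2 = swap 0 2 * swap 1 4 ∧ swap (3 : Fin 5) 4 * swap 0 2 = swap 0 2 * swap 3 4 ∧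
    swap (1 : Fin 5) 2 * swap 0 3 = swap 0 3 * swap 1 2 ∧ swap (1 : Fin 5) 4 * swap 0 3 = swap 0 3 * swap 1 4 ∧
    swap (2 : Fin 5) 4 * swap 0 3 = swap 0 3 * swap 2 4 ∧ swap (1 : Fin 5) 2 * swap 0 4 = swap 0 4 * swap 1 2 ∧
    swap (1 : Fin 5) 3 * swap 0 4 = swap 0 4 * swap 1 3 ∧ swap (2 : Fin 5) 3 * swap 0 4 = swap 0 4 * swap 2 3) ∧
    (swap (1 : Fin 5) 2 * swap 0 1 = swap 0 1 * swap 0 2 ∧ swap (1 : Fin 5) 3 * swap 0 1 = swap 0 1 * swap 0 3 ∧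
    swap (1 : Fin 5) 4 * swap 0 1 = swap 0 1 * swap 0 4 ∧ swap (1 : Fin 5) 2 * swap 0 2 = swap 0 2 * swap 0 1 ∧
    swap (2 : Fin 5) 3 * swap 0 2 = swap 0 2 * swap 0 3 ∧ swap (2 : Fin 5) 4 * swap 0 2 = swap 0 2 * swap 0 4 ∧
    swap (1 : Fin 5) 3 * swap 0 3 = swap 0 3 * swap 0 1 ∧ swap (2 : Fin 5) 3 * swap 0 3 = swap 0 3 * swap 0 2 ∧
    swap (3 : Fin 5) 4 * swap 0 3 = swap 0 3 * swap 0 4 ∧ swap (1 : Fin 5) 4 * swap 0 4 = swap 0 4 * swap 0 1 ∧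
    swap (2 : Fin 5) 4 * swap 0 4 = swap 0 4 * swap 0 2 ∧ swap (3 : Fin 5) 4 * swap 0 4 = swap 0 4 * swap 0 3) := by
  constructor <;> decide

/-- `Yd = Yd'` (both are "double transpositions through `0` minus `3`-cycles through `0`").
[folklore] -/
theorem Yd_eq_Yd' : Yd = Yd' := by
  obtain ⟨h1, h2, h3, h4, h5, h6, h7, h8, h9, h10, h11, h12⟩ := swap_zero_mul_swap_eq
  obtain ⟨⟨c1, c2, c3, c4, c5, c6, c7, c8, c9, c10, c11, c12⟩,
    ⟨d1, d2, d3, d4, d5, d6, d7, d8, d9, d10, d11, d12⟩⟩ := swap_mul_swap_zero_eq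
  rw [Yd, Yd', T₀, U₁, U₂, U₃, U₄]
  simp only [mul_sub, mul_add, sub_mul, add_mul, smul_mul_assoc, mul_smul_comm, ← map_mul,
    h1, h2, h3, h4, h5, h6, h7, h8, h9, h10, h11, h12,
    c1, c2, c3, c4, c5, c6, c7, c8, c9, c10, c11, c12, d1, d2, d3, d4, d5, d6, d7, d8, d9, d10, d11, d12]
  module

/-- **(B5): `B A⁽⁰⁾ = 0`** (CLR Lemma 3.3, eq. (B5)). [cite: CaputoLiggettRichthammer2010, §3.2 Lemma 3.3 (B5)] -/
theorem B5_mul_Aface_zero : B5 * Aface 0 = 0 := by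
  obtain ⟨yD, -⟩ := Yd_mul_eq_zero D₀ (Or.inl rfl)
  obtain ⟨yE, -⟩ := Yd_mul_eq_zero E₀ (Or.inr rfl)
  rw [B5_eq, Aface_zero_eq]
  simp only [sub_mul, add_mul, mul_sub, smul_mul_assoc, mul_smul_comm, one_mul, yD, yE, D₀_mul_D₀,
    D₀_mul_E₀, smul_zero, smul_smul]
  module

/-- **`A⁽⁰⁾ B = 0`**, the transpose of (B5). [cite: CaputoLiggettRichthammer2010, §3.2 Lemma 3.3 (after (B5))] -/
theorem Aface_zero_mul_B5 : Aface 0 * B5 = 0 := by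
  obtain ⟨-, yD⟩ := Yd_mul_eq_zero D₀ (Or.inl rfl)
  obtain ⟨-, yE⟩ := Yd_mul_eq_zero E₀ (Or.inr rfl)
  rw [B5_eq, Yd_eq_Yd', Aface_zero_eq]
  simp only [sub_mul, mul_add, mul_sub, smul_mul_assoc, mul_smul_comm, mul_one, yD, yE, D₀_mul_D₀,
    E₀_mul_D₀, smul_zero, smul_smul, sub_zero]
  module

/-- Conjugation by `σ` as an algebra automorphism of `ℂ[𝔖ₙ]`. [folklore] -/
def conjAlg {n : ℕ} (σ : Perm (Fin n)) : MonoidAlgebra ℂ (Perm (Fin n)) →ₐ[ℂ] MonoidAlgebra ℂ (Perm (Fin n)) :=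
  MonoidAlgebra.mapDomainAlgHom ℂ ℂ (MulAut.conj σ).toMonoidHom

/-- `conjAlg` on a group element. [folklore] -/
theorem conjAlg_of {n : ℕ} (σ g : Perm (Fin n)) :
    conjAlg σ (MonoidAlgebra.of ℂ _ g) = MonoidAlgebra.of ℂ _ (σ * g * σ⁻¹) := by
  rw [conjAlg, MonoidAlgebra.mapDomainAlgHom_apply, MonoidAlgebra.of_apply,
    MonoidAlgebra.mapDomain_single, MonoidAlgebra.of_apply]
  rfl

/-- Conjugating a transported permutation transports along the composed embedding. [folklore] -/
theorem conj_viaEmbeddingHom {k n : ℕ} (ι : Fin k ↪ Fin n) (σ : Perm (Fin n)) (g : Perm (Fin k)) :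
    σ * Perm.viaEmbeddingHom ι g * σ⁻¹ = Perm.viaEmbeddingHom (ι.trans σ.toEmbedding) g := by
  ext x
  simp only [Perm.viaEmbeddingHom_apply, Perm.mul_apply]
  by_cases hx : σ⁻¹ x ∈ Set.range ι
  · obtain ⟨a, ha⟩ := hx
    have hx' : x = (ι.trans σ.toEmbedding) a := by
      rw [Function.Embedding.trans_apply, Equiv.coe_toEmbedding, ha]
      simp
    rw [← ha, Perm.viaEmbedding_apply, hx', Perm.viaEmbedding_apply]
    rfl
  · have hx' : x ∉ Set.range (ι.trans σ.toEmbedding) := by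
      rintro ⟨a, rfl⟩
      apply hx
      refine ⟨a, ?_⟩
      simp
    rw [Perm.viaEmbedding_apply_of_notMem _ _ _ hx, Perm.viaEmbedding_apply_of_notMem _ _ _ hx']
    simp

/-- `conjAlg σ ∘ embAlg ι = embAlg (σ ∘ ι)`. [folklore] -/
theorem conjAlg_embAlg {k n : ℕ} (ι : Fin k ↪ Fin n) (σ : Perm (Fin n)) (a : MonoidAlgebra ℂ (Perm (Fin k))) :
    conjAlg σ (embAlg ι a) = embAlg (ι.trans σ.toEmbedding) a := by
  induction a using MonoidAlgebra.induction_on with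
  | hM g => rw [embAlg_of, conjAlg_of, embAlg_of, conj_viaEmbeddingHom]
  | hadd x y hx hy => rw [map_add, map_add, hx, hy, map_add]
  | hsmul r x hx => rw [map_smul, map_smul, hx, map_smul]

/-- `σ A^J σ⁻¹ = A^{σJ}`. [cite: CaputoLiggettRichthammer2010, §3.2 Lemma 3.2 (proof)] -/
theorem conjAlg_octA {n : ℕ} (ι : Fin 4 ↪ Fin n) (σ : Perm (Fin n)) :
    conjAlg σ (octA ι) = octA (ι.trans σ.toEmbedding) := conjAlg_embAlg ι σ A4

/-- The image of a face embedding is the complement of the omitted vertex. [folklore] -/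
theorem range_faceEmb (i : Fin 5) : Set.range (faceEmb i) = {i}ᶜ := Fin.range_succAbove i

/-- **`σ A⁽ⁱ⁾ σ⁻¹ = A⁽σ i⁾`** (CLR: "by symmetry we get the same relations for `A⁽ⁱ⁾` instead of
`A⁽⁰⁾`"). [cite: CaputoLiggettRichthammer2010, §3.2 Lemma 3.3 (proof)] -/
theorem conjAlg_Aface (σ : Perm (Fin 5)) (i : Fin 5) : conjAlg σ (Aface i) = Aface (σ i) := by
  rw [Aface, Aface, conjAlg_octA]
  apply octA_eq_of_range_eq
  have h1 : Set.range ((faceEmb i).trans σ.toEmbedding) = σ '' Set.range (faceEmb i) := by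
    ext x
    simp only [Set.mem_range, Function.Embedding.trans_apply, Equiv.coe_toEmbedding, Set.mem_image,
      exists_exists_eq_and]
  rw [h1, range_faceEmb, range_faceEmb, Equiv.image_compl, Set.image_singleton]

/-- `B⁺ = ∑_i A⁽ⁱ⁾` is conjugation invariant. [cite: CaputoLiggettRichthammer2010, §3.2 Lemma 3.3 (proof)] -/
theorem conjAlg_sum_Aface (σ : Perm (Fin 5)) : conjAlg σ (∑ i, Aface i) = ∑ i, Aface i := by
  rw [map_sum]
  simp_rw [conjAlg_Aface]
  exact Equiv.sum_comp σ Aface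

/-- **`B⁺ A⁽ᵖ⁾ = 24 A⁽ᵖ⁾`** for every `p` (CLR: "`B⁺ A⁽ⁱ⁾ = 2(A⁽ⁱ⁾)²`" and `(A⁽ⁱ⁾)² = 12 A⁽ⁱ⁾`).
[cite: CaputoLiggettRichthammer2010, §3.2 Lemma 3.3 (proof)] -/
theorem sum_Aface_mul_Aface (p : Fin 5) : (∑ i, Aface i) * Aface p = (24 : ℂ) • Aface p := by
  -- the case `p = 0` from (B5)
  have h0 : (∑ i, Aface i) * Aface 0 = (24 : ℂ) • Aface 0 := by
    have hA : Aface 0 * Aface 0 = (12 : ℂ) • Aface 0 := octA_mul_octA _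
    have h := B5_mul_Aface_zero
    rw [B5, sub_mul, sub_eq_zero, smul_mul_assoc, hA, smul_smul] at h
    rw [h]
    norm_num
  -- transport by conjugation with `(0 p)`
  have := congrArg (conjAlg (swap 0 p)) h0
  rwa [map_mul, map_smul, conjAlg_sum_Aface, conjAlg_Aface, swap_apply_left] at this

/-- **`A⁽ᵖ⁾ B⁺ = 24 A⁽ᵖ⁾`** for every `p`. [cite: CaputoLiggettRichthammer2010, §3.2 Lemma 3.3 (proof)] -/
theorem Aface_mul_sum_Aface (p : Fin 5) : Aface p * (∑ i, Aface i) = (24 : ℂ) • Aface p := by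
  have h0 : Aface 0 * (∑ i, Aface i) = (24 : ℂ) • Aface 0 := by
    have hA : Aface 0 * Aface 0 = (12 : ℂ) • Aface 0 := octA_mul_octA _
    have h := Aface_zero_mul_B5
    rw [B5, mul_sub, sub_eq_zero, mul_smul_comm, hA, smul_smul] at h
    rw [h]
    norm_num
  have := congrArg (conjAlg (swap 0 p)) h0
  rwa [map_mul, map_smul, conjAlg_sum_Aface, conjAlg_Aface, swap_apply_left] at this

/-- `(B⁺)² = 24 B⁺`. [cite: CaputoLiggettRichthammer2010, §3.2 Lemma 3.3 (proof)] -/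
theorem sum_Aface_mul_self : (∑ i, Aface i) * (∑ i, Aface i) = (24 : ℂ) • ∑ i, Aface i := by
  rw [Finset.mul_sum, Finset.smul_sum]
  exact Finset.sum_congr rfl fun p _ => Aface_mul_sum_Aface' p
where
  /-- auxiliary restatement -/
  Aface_mul_sum_Aface' (p : Fin 5) : (∑ i, Aface i) * Aface p = (24 : ℂ) • Aface p :=
    sum_Aface_mul_Aface p

/-- **CLR Lemma 3.3 in `ℂ[𝔖₅]`: `B² = 24 B`** ("`B/24` is a projection and thus has eigenvalues
`0, 1` only"). [cite: CaputoLiggettRichthammer2010, §3.2 Lemma 3.3] -/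
theorem B5_mul_B5 : B5 * B5 = (24 : ℂ) • B5 := by
  have hS := sum_Aface_mul_self
  have hL := sum_Aface_mul_Aface 0
  have hR := Aface_mul_sum_Aface 0
  have hA : Aface 0 * Aface 0 = (12 : ℂ) • Aface 0 := octA_mul_octA _
  rw [B5]
  simp only [sub_mul, mul_sub, smul_mul_assoc, mul_smul_comm, hS, hL, hR, hA, smul_sub, smul_smul]
  module

end S5

/-! ### `B^K(n) ≥ 0` for `5`-sets `K ⊆ Fin n` (CLR Lemma 3.3) and `A^J` indexed by finite sets -/

section OctB

variable {k m n : ℕ}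

/-- Transport along a composite embedding. [folklore] -/
theorem viaEmbeddingHom_viaEmbeddingHom (ι : Fin k ↪ Fin m) (κ : Fin m ↪ Fin n) (g : Perm (Fin k)) :
    Perm.viaEmbeddingHom κ (Perm.viaEmbeddingHom ι g) = Perm.viaEmbeddingHom (ι.trans κ) g := by
  ext x
  simp only [Perm.viaEmbeddingHom_apply]
  by_cases hx : x ∈ Set.range κ
  · obtain ⟨y, rfl⟩ := hx
    rw [Perm.viaEmbedding_apply]
    by_cases hy : y ∈ Set.range ι
    · obtain ⟨z, rfl⟩ := hy
      rw [Perm.viaEmbedding_apply, show κ (ι z) = (ι.trans κ) z from rfl, Perm.viaEmbedding_apply]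
      rfl
    · rw [Perm.viaEmbedding_apply_of_notMem _ _ _ hy, Perm.viaEmbedding_apply_of_notMem]
      rintro ⟨z, hz⟩
      exact hy ⟨z, κ.injective hz⟩
  · rw [Perm.viaEmbedding_apply_of_notMem _ _ _ hx, Perm.viaEmbedding_apply_of_notMem]
    rintro ⟨z, rfl⟩
    exact hx ⟨ι z, rfl⟩

/-- `embAlg κ ∘ embAlg ι = embAlg (κ ∘ ι)`. [folklore] -/
theorem embAlg_embAlg (ι : Fin k ↪ Fin m) (κ : Fin m ↪ Fin n) (a : MonoidAlgebra ℂ (Perm (Fin k))) :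
    embAlg κ (embAlg ι a) = embAlg (ι.trans κ) a := by
  induction a using MonoidAlgebra.induction_on with
  | hM g => rw [embAlg_of, embAlg_of, embAlg_of, viaEmbeddingHom_viaEmbeddingHom]
  | hadd x y hx hy => rw [map_add, map_add, hx, hy, map_add]
  | hsmul r x hx => rw [map_smul, map_smul, hx, map_smul]

/-- **CLR's `B^K(n) ∈ ℂ[𝔖ₙ]`** for the `5`-set `K = κ(Fin 5)` with distinguished vertex `κ 0`:
the transport of `B`. [cite: CaputoLiggettRichthammer2010, §3.2 Lemma 3.3 (propB)] -/
def octB (κ : Fin 5 ↪ Fin n) : MonoidAlgebra ℂ (Perm (Fin n)) := embAlg κ B5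

/-- `B^K = ∑_i A^{K ∖ κ i} − 2 A^{K ∖ κ 0}`. [cite: CaputoLiggettRichthammer2010, §3.2 Lemma 3.3 (propB)] -/
theorem octB_eq (κ : Fin 5 ↪ Fin n) :
    octB κ = ∑ i, octA ((faceEmb i).trans κ) - (2 : ℂ) • octA ((faceEmb 0).trans κ) := by
  rw [octB, B5, map_sub, map_smul, map_sum]
  simp only [Aface, octA, embAlg_embAlg]

/-- **`(B^K)² = 24 B^K`.** [cite: CaputoLiggettRichthammer2010, §3.2 Lemma 3.3] -/
theorem octB_mul_octB (κ : Fin 5 ↪ Fin n) : octB κ * octB κ = (24 : ℂ) • octB κ := by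
  rw [octB, ← map_mul, B5_mul_B5, map_smul]

/-- `λ(B^K)` is self-adjoint. [cite: CaputoLiggettRichthammer2010, §3.2 Lemma 3.3] -/
theorem l2Inner_regOp_octB_comm (κ : Fin 5 ↪ Fin n) (f h : Perm (Fin n) → ℂ) :
    l2Inner f (regOp n (octB κ) h) = l2Inner (regOp n (octB κ) f) h := by
  rw [octB_eq, map_sub, map_smul, map_sum, LinearMap.sub_apply, LinearMap.sub_apply,
    LinearMap.smul_apply, LinearMap.smul_apply, LinearMap.sum_apply, LinearMap.sum_apply,
    l2Inner_sub_right, l2Inner_sub_left, l2Inner_smul_right, l2Inner_smul_left, map_ofNat,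
    l2Inner_sum_right, l2Inner_sum_left, l2Inner_regOp_octA_comm]
  congr 1
  exact Finset.sum_congr rfl fun i _ => l2Inner_regOp_octA_comm _ f h

/-- **CLR Lemma 3.3: `B^K(n) ≥ 0`.** [cite: CaputoLiggettRichthammer2010, §3.2 Lemma 3.3] -/
theorem re_l2Inner_regOp_octB_nonneg (κ : Fin 5 ↪ Fin n) (f : Perm (Fin n) → ℂ) :
    0 ≤ (l2Inner f (regOp n (octB κ) f)).re := by
  refine re_l2Inner_nonneg_of_sq _ (by norm_num : (0 : ℝ) < 24) ?_ (l2Inner_regOp_octB_comm κ) f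
  rw [← map_mul, octB_mul_octB, map_smul]
  norm_num

/-- The quadratic form `q_J(f) = Re⟪f, λ(A^J) f⟫ ≥ 0` attached to an embedding of `Fin 4`.
[cite: CaputoLiggettRichthammer2010, §3.2] -/
def qA (ι : Fin 4 ↪ Fin n) (f : Perm (Fin n) → ℂ) : ℝ := (l2Inner f (regOp n (octA ι) f)).re

/-- Unfolding lemma for `qA`. [folklore] -/
theorem qA_def (ι : Fin 4 ↪ Fin n) (f : Perm (Fin n) → ℂ) : qA ι f = (l2Inner f (regOp n (octA ι) f)).re :=
  rfl

/-- `q_J(f) ≥ 0`. [cite: CaputoLiggettRichthammer2010, §3.2 Lemma 3.2] -/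
theorem qA_nonneg (ι : Fin 4 ↪ Fin n) (f : Perm (Fin n) → ℂ) : 0 ≤ qA ι f :=
  re_l2Inner_regOp_octA_nonneg ι f

/-- `q` depends only on the image of the embedding. [cite: CaputoLiggettRichthammer2010, §3.2] -/
theorem qA_eq_of_range_eq {ι ι' : Fin 4 ↪ Fin n} (h : Set.range ι = Set.range ι') (f : Perm (Fin n) → ℂ) :
    qA ι f = qA ι' f := by
  rw [qA, qA, octA_eq_of_range_eq h]

/-- **The face inequality from `B^K ≥ 0`**: `q_{K∖κ0}(f) ≤ ∑_{i ≠ 0} q_{K∖κ i}(f)`.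
[cite: CaputoLiggettRichthammer2010, §3.3 Lemma 3.4 (proof, first inequality)] -/
theorem qA_face_zero_le (κ : Fin 5 ↪ Fin n) (f : Perm (Fin n) → ℂ) :
    qA ((faceEmb 0).trans κ) f ≤ ∑ i : Fin 4, qA ((faceEmb i.succ).trans κ) f := by
  have h := re_l2Inner_regOp_octB_nonneg κ f
  rw [octB_eq, map_sub, map_smul, map_sum, LinearMap.sub_apply, LinearMap.smul_apply,
    LinearMap.sum_apply, l2Inner_sub_right, l2Inner_smul_right, l2Inner_sum_right, Complex.sub_re,
    Complex.re_sum, Fin.sum_univ_succ] at h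
  have h2 : ((2 : ℂ) * l2Inner f (regOp n (octA ((faceEmb 0).trans κ)) f)).re =
      2 * qA ((faceEmb 0).trans κ) f := by
    rw [qA, show (2 : ℂ) = ((2 : ℝ) : ℂ) by norm_num, Complex.re_ofReal_mul]
  rw [h2] at h
  simp only [qA] at h ⊢
  linarith

end OctB

/-! ### CLR Lemma 3.1: `c² − Θ² = ∑_J (−c_J) A^J` in `ℂ[𝔖ₙ]` -/

section Lemma31

variable {n : ℕ}

/-- The increasing pairs `(u, v)`, `u < v`, of `Fin n` (the edges `b = {u,v}` of the complete graph).
[folklore] -/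
def prs (n : ℕ) : Finset (Fin n × Fin n) := Finset.univ.filter fun p => p.1 < p.2

/-- Membership in `prs`. [folklore] -/
theorem mem_prs {p : Fin n × Fin n} : p ∈ prs n ↔ p.1 < p.2 := by
  simp [prs]

/-- Sums over increasing pairs as iterated sums. [folklore] -/
theorem sum_prs {M : Type*} [AddCommMonoid M] (F : Fin n × Fin n → M) :
    ∑ p ∈ prs n, F p = ∑ x : Fin n, ∑ y : Fin n with x < y, F (x, y) := by
  rw [prs, Finset.sum_filter, ← Finset.univ_product_univ, Finset.sum_product]
  refine Finset.sum_congr rfl fun x _ => ?_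
  rw [Finset.sum_filter]

/-- The support `{p₁, p₂, q₁, q₂}` of a pair of pairs. [folklore] -/
def supp4 (pq : (Fin n × Fin n) × (Fin n × Fin n)) : Finset (Fin n) :=
  {pq.1.1, pq.1.2, pq.2.1, pq.2.2}

/-- **CLR's `Θ = ∑_{u<v} c_u c_v τ_{uv} ∈ ℂ[𝔖ₙ]`** (the off-diagonal part of the matrix `C` of
(defC)). [cite: CaputoLiggettRichthammer2010, §3 (defC)] -/
def theta (C : Fin n → ℝ) : MonoidAlgebra ℂ (Perm (Fin n)) :=
  ∑ p ∈ prs n, ((C p.1 * C p.2 : ℝ) : ℂ) • MonoidAlgebra.of ℂ _ (swap p.1 p.2)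

/-- `A^J` for a finite set `J` (zero unless `|J| = 4`). [cite: CaputoLiggettRichthammer2010, §3.2 (defmat)] -/
def octAset (J : Finset (Fin n)) : MonoidAlgebra ℂ (Perm (Fin n)) :=
  if h : J.card = 4 then octA (J.orderEmbOfFin h).toEmbedding else 0

/-- `R^T = ρ_T + ρ_T⁻¹`, the two `3`-cycles of a `3`-set `T` (zero unless `|T| = 3`). [folklore] -/
def octR (T : Finset (Fin n)) : MonoidAlgebra ℂ (Perm (Fin n)) :=
  if h : T.card = 3 then
    embAlg (T.orderEmbOfFin h).toEmbedding
      (MonoidAlgebra.of ℂ _ (swap 0 1 * swap 0 2) + MonoidAlgebra.of ℂ _ (swap 0 2 * swap 0 1))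
  else 0

/-- The two `3`-cycles of `Fin 3` as an element of `ℂ[𝔖₃]`. [folklore] -/
def R3 : MonoidAlgebra ℂ (Perm (Fin 3)) :=
  MonoidAlgebra.of ℂ _ (swap 0 1 * swap 0 2) + MonoidAlgebra.of ℂ _ (swap 0 2 * swap 0 1)

/-- Unfolding of `octR` on a `3`-set. [folklore] -/
theorem octR_eq {T : Finset (Fin n)} (h : T.card = 3) :
    octR T = embAlg (T.orderEmbOfFin h).toEmbedding R3 := by
  rw [octR, dif_pos h, R3]

/-- Unfolding of `octAset` on a `4`-set. [folklore] -/
theorem octAset_eq {J : Finset (Fin n)} (h : J.card = 4) :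
    octAset J = octA (J.orderEmbOfFin h).toEmbedding := by
  rw [octAset, dif_pos h]

/-- **Expansion of `Θ²`** as a sum over ordered pairs of edges. [cite: CaputoLiggettRichthammer2010, §3.2 Lemma 3.1 (proof)] -/
theorem theta_mul_theta_expand (C : Fin n → ℝ) :
    theta C * theta C =
      ∑ pq ∈ prs n ×ˢ prs n, ((C pq.1.1 * C pq.1.2 * (C pq.2.1 * C pq.2.2) : ℝ) : ℂ) •
        MonoidAlgebra.of ℂ _ (swap pq.1.1 pq.1.2 * swap pq.2.1 pq.2.2) := by
  rw [theta, Finset.sum_mul_sum, ← Finset.sum_product']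
  refine Finset.sum_congr rfl fun pq _ => ?_
  rw [smul_mul_smul_comm, ← map_mul, ← Complex.ofReal_mul]

/-- `λ(Θ) f = ∑_{u<v} c_uc_v f((uv)·)`. [cite: CaputoLiggettRichthammer2010, §3 (defC)] -/
theorem regOp_theta_apply (C : Fin n → ℝ) (f : Perm (Fin n) → ℂ) (τ : Perm (Fin n)) :
    regOp n (theta C) f τ = ∑ p ∈ prs n, ((C p.1 * C p.2 : ℝ) : ℂ) * f (swap p.1 p.2 * τ) := by
  rw [theta, map_sum, LinearMap.sum_apply, Finset.sum_apply]
  refine Finset.sum_congr rfl fun p _ => ?_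
  rw [map_smul, LinearMap.smul_apply, Pi.smul_apply, regOp_of_swap_apply, smul_eq_mul]

/-- `λ(Θ) f` as a combination of shifted functions. [cite: CaputoLiggettRichthammer2010, §3 (defC)] -/
theorem regOp_theta_eq (C : Fin n → ℝ) (f : Perm (Fin n) → ℂ) :
    (regOp n (theta C) f : Perm (Fin n) → ℂ) =
      ∑ p ∈ prs n, ((C p.1 * C p.2 : ℝ) : ℂ) • fun τ => f (swap p.1 p.2 * τ) := by
  funext τ
  rw [regOp_theta_apply, Finset.sum_apply]
  rfl

/-! #### Small combinatorics of supports -/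

/-- `|{p₁,p₂,q₁,q₂}| ≤ 4`. [folklore] -/
theorem card_supp4_le (pq : (Fin n × Fin n) × (Fin n × Fin n)) : (supp4 pq).card ≤ 4 := by
  unfold supp4
  exact Finset.card_le_four

/-- Distinct increasing pairs have a support of size at least `3`. [folklore] -/
theorem three_le_card_supp4 {pq : (Fin n × Fin n) × (Fin n × Fin n)} (hp : pq.1 ∈ prs n) (hq : pq.2 ∈ prs n)
    (hne : pq.1 ≠ pq.2) : 3 ≤ (supp4 pq).card := by
  obtain ⟨p, q⟩ := pq
  simp only at hp hq hne
  rw [mem_prs] at hp hq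
  by_contra hlt
  push Not at hlt
  have hsub : ({p.1, p.2} : Finset (Fin n)) ⊆ supp4 (p, q) := by
    intro x hx
    simp only [Finset.mem_insert, Finset.mem_singleton] at hx
    unfold supp4
    rcases hx with rfl | rfl <;> simp
  have hcard2 : ({p.1, p.2} : Finset (Fin n)).card = 2 := Finset.card_pair hp.ne
  have heq : ({p.1, p.2} : Finset (Fin n)) = supp4 (p, q) :=
    Finset.eq_of_subset_of_card_le hsub (by omega)
  have hq1 : q.1 ∈ ({p.1, p.2} : Finset (Fin n)) := by rw [heq]; unfold supp4; simp
  have hq2 : q.2 ∈ ({p.1, p.2} : Finset (Fin n)) := by rw [heq]; unfold supp4; simp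
  simp only [Finset.mem_insert, Finset.mem_singleton] at hq1 hq2
  apply hne
  rcases hq1 with h1 | h1 <;> rcases hq2 with h2 | h2
  · exact absurd (h1.trans h2.symm) hq.ne
  · exact (Prod.ext h1 h2).symm
  · rw [h1, h2] at hq
    exact absurd (hp.trans hq) (lt_irrefl _)
  · exact absurd (h1.trans h2.symm) hq.ne

/-- If the support has four elements the four entries are pairwise distinct. [folklore] -/
theorem nodup_of_card_supp4 {a b c d : Fin n} (h4 : (supp4 ((a, b), (c, d))).card = 4) :
    a ∉ ({b, c, d} : Finset (Fin n)) ∧ b ∉ ({c, d} : Finset (Fin n)) ∧ c ≠ d := by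
  unfold supp4 at h4
  simp only at h4
  refine ⟨fun h => ?_, fun h => ?_, ?_⟩
  · rw [Finset.insert_eq_of_mem h] at h4
    have := Finset.card_le_three (a := b) (b := c) (c := d)
    omega
  · rw [Finset.insert_eq_of_mem h] at h4
    have := Finset.card_le_three (a := a) (b := c) (c := d)
    omega
  · rintro rfl
    rw [Finset.insert_eq_of_mem (Finset.mem_singleton_self c)] at h4
    have := Finset.card_le_three (a := a) (b := b) (c := c)
    omega

/-- If the support has four elements the weight is the product over the support. [folklore] -/
theorem weight_eq_prod_of_card_eq_four (C : Fin n → ℝ) {pq : (Fin n × Fin n) × (Fin n × Fin n)}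
    (h4 : (supp4 pq).card = 4) :
    C pq.1.1 * C pq.1.2 * (C pq.2.1 * C pq.2.2) = ∏ v ∈ supp4 pq, C v := by
  obtain ⟨⟨a, b⟩, ⟨c, d⟩⟩ := pq
  obtain ⟨ha, hb, hcd⟩ := nodup_of_card_supp4 h4
  unfold supp4
  simp only
  rw [Finset.prod_insert ha, Finset.prod_insert hb, Finset.prod_pair hcd]
  ring

/-! #### The six splittings of a `4`-set and of a `3`-set into two increasing pairs -/

/-- The six ordered splittings of `Fin 4` into two increasing pairs. [folklore] -/
def six4 : Finset ((Fin 4 × Fin 4) × (Fin 4 × Fin 4)) :=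
  {((0, 1), (2, 3)), ((2, 3), (0, 1)), ((0, 2), (1, 3)), ((1, 3), (0, 2)), ((0, 3), (1, 2)), ((1, 2), (0, 3))}

set_option maxRecDepth 4000 in
/-- Properties of the six splittings. [folklore] -/
theorem six4_props : ∀ σ ∈ six4, σ.1.1 < σ.1.2 ∧ σ.2.1 < σ.2.2 ∧ σ.1 ≠ σ.2 ∧
    σ.1.1 ∉ ({σ.1.2, σ.2.1, σ.2.2} : Finset (Fin 4)) ∧ σ.1.2 ∉ ({σ.2.1, σ.2.2} : Finset (Fin 4)) ∧
    σ.2.1 ≠ σ.2.2 := by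
  unfold six4; decide

set_option maxRecDepth 4000 in
/-- Completeness of the six splittings. [folklore] -/
theorem mem_six4 : ∀ a b c d : Fin 4, a < b → c < d → a ∉ ({b, c, d} : Finset (Fin 4)) →
    b ∉ ({c, d} : Finset (Fin 4)) → c ≠ d → ((a, b), (c, d)) ∈ six4 := by
  unfold six4; decide

/-- Four pairwise distinct entries have a support of size `4`. [folklore] -/
theorem card_supp4_eq_four {n : ℕ} {a b c d : Fin n} (ha : a ∉ ({b, c, d} : Finset (Fin n)))
    (hb : b ∉ ({c, d} : Finset (Fin n))) (hcd : c ≠ d) : (supp4 ((a, b), (c, d))).card = 4 := by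
  unfold supp4
  simp only
  rw [Finset.card_insert_of_notMem ha, Finset.card_insert_of_notMem hb, Finset.card_pair hcd]

/-- The six ordered pairs of distinct increasing pairs in `Fin 3`. [folklore] -/
def six3 : Finset ((Fin 3 × Fin 3) × (Fin 3 × Fin 3)) :=
  {((0, 1), (0, 2)), ((0, 2), (0, 1)), ((0, 1), (1, 2)), ((1, 2), (0, 1)), ((0, 2), (1, 2)), ((1, 2), (0, 2))}

set_option maxRecDepth 4000 in
/-- Properties of the six pairs. [folklore] -/
theorem six3_props : ∀ σ ∈ six3, σ.1.1 < σ.1.2 ∧ σ.2.1 < σ.2.2 ∧ σ.1 ≠ σ.2 ∧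
    ({σ.1.1, σ.1.2, σ.2.1, σ.2.2} : Finset (Fin 3)) = Finset.univ := by
  unfold six3; decide

set_option maxRecDepth 4000 in
/-- Completeness of the six pairs. [folklore] -/
theorem mem_six3 : ∀ a b c d : Fin 3, a < b → c < d → (a, b) ≠ (c, d) → ((a, b), (c, d)) ∈ six3 := by
  unfold six3; decide

/-- **`P₄ := ∑` over the six splittings of `(ab)(cd) = 2(𝟙_V − 1)`** (each double transposition
arises from the two orders of its factors; CLR Lemma 3.1 (a): "a complete list of decompositions
of `η⁻¹η'` into a product of two transpositions is `(01)(23) = (23)(01)`").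
[cite: CaputoLiggettRichthammer2010, §3.2 Lemma 3.1 (a)] -/
theorem sum_six4_eq :
    ∑ σ ∈ six4, MonoidAlgebra.of ℂ (Perm (Fin 4)) (swap σ.1.1 σ.1.2 * swap σ.2.1 σ.2.2) =
      (2 : ℂ) • (D4 - 1) := by
  have e1 : swap (2 : Fin 4) 3 * swap 0 1 = swap 0 1 * swap 2 3 := by decide
  have e2 : swap (1 : Fin 4) 3 * swap 0 2 = swap 0 2 * swap 1 3 := by decide
  have e3 : swap (1 : Fin 4) 2 * swap 0 3 = swap 0 3 * swap 1 2 := by decide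
  rw [six4, Finset.sum_insert (by decide), Finset.sum_insert (by decide), Finset.sum_insert (by decide),
    Finset.sum_insert (by decide), Finset.sum_insert (by decide), Finset.sum_singleton, D4_expand]
  simp only [e1, e2, e3, kα, kβ, kγ]
  module

/-- In `𝔖₃`: `(01)(12) = (02)(01)`, `(12)(01) = (01)(02)`, `(02)(12) = (01)(02)`,
`(12)(02) = (02)(01)` (CLR Lemma 3.1 (b): "`(012) = (01)(20) = (12)(01) = (20)(12)`").
[cite: CaputoLiggettRichthammer2010, §3.2 Lemma 3.1 (b)] -/
theorem swap_fin3_eq :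
    swap (0 : Fin 3) 1 * swap 1 2 = swap 0 2 * swap 0 1 ∧ swap (1 : Fin 3) 2 * swap 0 1 = swap 0 1 * swap 0 2 ∧
    swap (0 : Fin 3) 2 * swap 1 2 = swap 0 1 * swap 0 2 ∧ swap (1 : Fin 3) 2 * swap 0 2 = swap 0 2 * swap 0 1 := by
  decide

/-- `P^J`: the sum over the six splittings of a `4`-set `J` into two edges (zero unless `|J| = 4`).
[cite: CaputoLiggettRichthammer2010, §3.2 Lemma 3.1 (a)] -/
def octP (J : Finset (Fin n)) : MonoidAlgebra ℂ (Perm (Fin n)) :=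
  if h : J.card = 4 then
    embAlg (J.orderEmbOfFin h).toEmbedding
      (∑ σ ∈ six4, MonoidAlgebra.of ℂ (Perm (Fin 4)) (swap σ.1.1 σ.1.2 * swap σ.2.1 σ.2.2))
  else 0

/-- `TC^J`: the sum of the eight `3`-cycles of a `4`-set `J` (zero unless `|J| = 4`).
[cite: CaputoLiggettRichthammer2010, §3.2 Lemma 3.1 (b)] -/
def octTC (J : Finset (Fin n)) : MonoidAlgebra ℂ (Perm (Fin n)) :=
  if h : J.card = 4 then embAlg (J.orderEmbOfFin h).toEmbedding (setSum threeCycleSet) else 0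

/-! #### The fibre over a `4`-set -/

/-- The set of off-diagonal ordered pairs of edges with support a given set `J`. [folklore] -/
def fib (J : Finset (Fin n)) : Finset ((Fin n × Fin n) × (Fin n × Fin n)) :=
  (prs n ×ˢ prs n).filter fun pq => pq.1 ≠ pq.2 ∧ supp4 pq = J

/-- Membership in `fib J`. [folklore] -/
theorem mem_fib {J : Finset (Fin n)} {pq : (Fin n × Fin n) × (Fin n × Fin n)} :
    pq ∈ fib J ↔ pq.1.1 < pq.1.2 ∧ pq.2.1 < pq.2.2 ∧ pq.1 ≠ pq.2 ∧ supp4 pq = J := by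
  simp only [fib, Finset.mem_filter, Finset.mem_product, mem_prs, and_assoc]

/-- An element of a finite set is hit by its increasing enumeration. [folklore] -/
theorem exists_orderEmbOfFin_eq {k : ℕ} {J : Finset (Fin n)} (h : J.card = k) {x : Fin n} (hx : x ∈ J) :
    ∃ a : Fin k, J.orderEmbOfFin h a = x := by
  have : x ∈ Set.range (J.orderEmbOfFin h) := by rw [Finset.range_orderEmbOfFin]; exact hx
  exact this

/-- The image of a four-element literal. [folklore] -/
theorem image_four {α β : Type*} [DecidableEq α] [DecidableEq β] (f : α → β) (a b c d : α) :
    ({a, b, c, d} : Finset α).image f = {f a, f b, f c, f d} := by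
  simp only [Finset.image_insert, Finset.image_singleton]

/-- **The fibre over a `4`-set `J`**: the ordered pairs of edges with support `J` are the images
under the enumeration of `J` of the six splittings, all with weight `c_J`.
[cite: CaputoLiggettRichthammer2010, §3.2 Lemma 3.1 (a)] -/
theorem sum_fib_four (C : Fin n → ℝ) {J : Finset (Fin n)} (hJ : J.card = 4) :
    ∑ pq ∈ fib J, ((C pq.1.1 * C pq.1.2 * (C pq.2.1 * C pq.2.2) : ℝ) : ℂ) •
        MonoidAlgebra.of ℂ _ (swap pq.1.1 pq.1.2 * swap pq.2.1 pq.2.2) =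
      ((∏ v ∈ J, C v : ℝ) : ℂ) • embAlg (J.orderEmbOfFin hJ).toEmbedding
        (∑ σ ∈ six4, MonoidAlgebra.of ℂ (Perm (Fin 4)) (swap σ.1.1 σ.1.2 * swap σ.2.1 σ.2.2)) := by
  set ι := J.orderEmbOfFin hJ with hι
  -- the support of the image of a splitting is `J`
  have hsuppJ : ∀ σ ∈ six4, supp4 ((ι σ.1.1, ι σ.1.2), (ι σ.2.1, ι σ.2.2)) = J := by
    intro σ hσ
    obtain ⟨-, -, -, h4, h5, h6⟩ := six4_props σ hσ
    refine Finset.eq_of_subset_of_card_le ?_ (le_of_eq ?_)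
    · intro x hx
      unfold supp4 at hx
      simp only [Finset.mem_insert, Finset.mem_singleton] at hx
      rcases hx with rfl | rfl | rfl | rfl <;> exact Finset.orderEmbOfFin_mem J hJ _
    · rw [hJ, card_supp4_eq_four]
      · simpa only [Finset.mem_insert, Finset.mem_singleton, EmbeddingLike.apply_eq_iff_eq] using h4
      · simpa only [Finset.mem_insert, Finset.mem_singleton, EmbeddingLike.apply_eq_iff_eq] using h5
      · exact fun h => h6 (ι.injective h)
  rw [map_sum, Finset.smul_sum]
  symm
  refine Finset.sum_bij (fun σ _ => ((ι σ.1.1, ι σ.1.2), (ι σ.2.1, ι σ.2.2))) ?_ ?_ ?_ ?_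
  · -- maps into the fibre
    intro σ hσ
    obtain ⟨h1, h2, h3, -, -, -⟩ := six4_props σ hσ
    rw [mem_fib]
    refine ⟨ι.strictMono h1, ι.strictMono h2, ?_, hsuppJ σ hσ⟩
    intro h
    apply h3
    simp only [Prod.mk.injEq] at h
    exact Prod.ext (ι.injective h.1) (ι.injective h.2)
  · -- injective
    intro σ _ σ' _ h
    simp only [Prod.mk.injEq] at h
    exact Prod.ext (Prod.ext (ι.injective h.1.1) (ι.injective h.1.2))
      (Prod.ext (ι.injective h.2.1) (ι.injective h.2.2))
  · -- surjective
    intro pq hpq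
    obtain ⟨h1, h2, h3, h4⟩ := mem_fib.mp hpq
    have hmem : ∀ x, x ∈ supp4 pq → ∃ a : Fin 4, ι a = x := fun x hx =>
      exists_orderEmbOfFin_eq hJ (h4 ▸ hx)
    obtain ⟨⟨p1, p2⟩, ⟨q1, q2⟩⟩ := pq
    obtain ⟨a, rfl⟩ := hmem p1 (by unfold supp4; simp)
    obtain ⟨b, rfl⟩ := hmem p2 (by unfold supp4; simp)
    obtain ⟨c, rfl⟩ := hmem q1 (by unfold supp4; simp)
    obtain ⟨d, rfl⟩ := hmem q2 (by unfold supp4; simp)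
    have hcard : (supp4 ((ι a, ι b), (ι c, ι d))).card = 4 := by rw [h4, hJ]
    obtain ⟨ha, hb, hcd⟩ := nodup_of_card_supp4 hcard
    refine ⟨((a, b), (c, d)), ?_, rfl⟩
    refine mem_six4 a b c d (ι.lt_iff_lt.mp h1) (ι.lt_iff_lt.mp h2) ?_ ?_ (fun h => hcd (congrArg ι h))
    · simpa only [Finset.mem_insert, Finset.mem_singleton, EmbeddingLike.apply_eq_iff_eq] using ha
    · simpa only [Finset.mem_insert, Finset.mem_singleton, EmbeddingLike.apply_eq_iff_eq] using hb
  · -- summands agree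
    intro σ hσ
    rw [embAlg_of_swap_mul_swap]
    congr 1
    rw [weight_eq_prod_of_card_eq_four C (pq := ((ι σ.1.1, ι σ.1.2), (ι σ.2.1, ι σ.2.2)))
      (by rw [hsuppJ σ hσ, hJ]), hsuppJ σ hσ]

/-! #### The fibre over a `3`-set -/

/-- **The fibre over a `3`-set `T`**: the ordered pairs of distinct edges with support `T` are
the images under the enumeration of `T` of the six pairs of `Fin 3`.
[cite: CaputoLiggettRichthammer2010, §3.2 Lemma 3.1 (b)] -/
theorem sum_fib_three (C : Fin n → ℝ) {T : Finset (Fin n)} (hT : T.card = 3) :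
    ∑ pq ∈ fib T, ((C pq.1.1 * C pq.1.2 * (C pq.2.1 * C pq.2.2) : ℝ) : ℂ) •
        MonoidAlgebra.of ℂ _ (swap pq.1.1 pq.1.2 * swap pq.2.1 pq.2.2) =
      ∑ σ ∈ six3, ((C (T.orderEmbOfFin hT σ.1.1) * C (T.orderEmbOfFin hT σ.1.2) *
          (C (T.orderEmbOfFin hT σ.2.1) * C (T.orderEmbOfFin hT σ.2.2)) : ℝ) : ℂ) •
        MonoidAlgebra.of ℂ _ (swap (T.orderEmbOfFin hT σ.1.1) (T.orderEmbOfFin hT σ.1.2) *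
          swap (T.orderEmbOfFin hT σ.2.1) (T.orderEmbOfFin hT σ.2.2)) := by
  set ι := T.orderEmbOfFin hT with hι
  have hTuniv : Finset.univ.image ι = T := Finset.image_orderEmbOfFin_univ T hT
  symm
  refine Finset.sum_bij (fun σ _ => ((ι σ.1.1, ι σ.1.2), (ι σ.2.1, ι σ.2.2))) ?_ ?_ ?_ ?_
  · intro σ hσ
    obtain ⟨h1, h2, h3, h4⟩ := six3_props σ hσ
    rw [mem_fib]
    refine ⟨ι.strictMono h1, ι.strictMono h2, ?_, ?_⟩
    · intro h
      apply h3
      simp only [Prod.mk.injEq] at h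
      exact Prod.ext (ι.injective h.1) (ι.injective h.2)
    · unfold supp4
      simp only
      rw [← image_four, h4, hTuniv]
  · intro σ _ σ' _ h
    simp only [Prod.mk.injEq] at h
    exact Prod.ext (Prod.ext (ι.injective h.1.1) (ι.injective h.1.2))
      (Prod.ext (ι.injective h.2.1) (ι.injective h.2.2))
  · intro pq hpq
    obtain ⟨h1, h2, h3, h4⟩ := mem_fib.mp hpq
    have hmem : ∀ x, x ∈ supp4 pq → ∃ a : Fin 3, ι a = x := fun x hx =>
      exists_orderEmbOfFin_eq hT (h4 ▸ hx)
    obtain ⟨a, ha⟩ := hmem pq.1.1 (by unfold supp4; simp)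
    obtain ⟨b, hb⟩ := hmem pq.1.2 (by unfold supp4; simp)
    obtain ⟨c, hc⟩ := hmem pq.2.1 (by unfold supp4; simp)
    obtain ⟨d, hd⟩ := hmem pq.2.2 (by unfold supp4; simp)
    refine ⟨((a, b), (c, d)), ?_, ?_⟩
    · refine mem_six3 a b c d ?_ ?_ ?_
      · rw [← ι.lt_iff_lt, ha, hb]; exact h1
      · rw [← ι.lt_iff_lt, hc, hd]; exact h2
      · intro h
        apply h3
        simp only [Prod.mk.injEq] at h
        exact Prod.ext (by rw [← ha, ← hc, h.1]) (by rw [← hb, ← hd, h.2])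
    · simp only [ha, hb, hc, hd]
  · intro σ _
    rfl

/-- **Evaluation of the fibre over a `3`-set**: `∑ = c_T s_T · R^T` with `c_T = ∏_{v∈T} c_v`,
`s_T = ∑_{v ∈ T} c_v` (CLR Lemma 3.1 (b): the coefficient of a `3`-cycle on `K` in `Θ²` is
`c_K ∑_{i ∈ K} c_i`). [cite: CaputoLiggettRichthammer2010, §3.2 Lemma 3.1 (b)] -/
theorem sum_fib_three_eq (C : Fin n → ℝ) {T : Finset (Fin n)} (hT : T.card = 3) :
    ∑ pq ∈ fib T, ((C pq.1.1 * C pq.1.2 * (C pq.2.1 * C pq.2.2) : ℝ) : ℂ) •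
        MonoidAlgebra.of ℂ _ (swap pq.1.1 pq.1.2 * swap pq.2.1 pq.2.2) =
      (((∏ v ∈ T, C v) * ∑ v ∈ T, C v : ℝ) : ℂ) • octR T := by
  obtain ⟨e1, e2, e3, e4⟩ := swap_fin3_eq
  set ι := T.orderEmbOfFin hT with hι
  have hprod : ∏ v ∈ T, C v = C (ι 0) * C (ι 1) * C (ι 2) := by
    rw [← Finset.map_orderEmbOfFin_univ T hT, Finset.prod_map, Fin.prod_univ_three]
    rfl
  have hsum : ∑ v ∈ T, C v = C (ι 0) + C (ι 1) + C (ι 2) := by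
    rw [← Finset.map_orderEmbOfFin_univ T hT, Finset.sum_map, Fin.sum_univ_three]
    rfl
  rw [sum_fib_three C hT, octR_eq hT, hprod, hsum, six3, Finset.sum_insert (by decide),
    Finset.sum_insert (by decide), Finset.sum_insert (by decide), Finset.sum_insert (by decide),
    Finset.sum_insert (by decide), Finset.sum_singleton, R3, map_add]
  simp only [← hι]
  simp only [show ∀ a b c d : Fin 3, MonoidAlgebra.of ℂ _ (swap (ι a) (ι b) * swap (ι c) (ι d)) =
      embAlg ι.toEmbedding (MonoidAlgebra.of ℂ _ (swap a b * swap c d)) from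
      fun a b c d => (embAlg_of_swap_mul_swap ι.toEmbedding a b c d).symm, e1, e2, e3, e4]
  push_cast
  module

/-! #### Regrouping `3`-sets with an extra vertex as `4`-sets with a marked vertex -/

/-- `∑_{|J| = k+1} ∑_{m ∈ J} F(J ∖ m, m) = ∑_{|T| = k} ∑_{z ∉ T} F(T, z)`. [folklore] -/
theorem sum_powersetCard_succ_erase {M : Type*} [AddCommMonoid M] (k : ℕ)
    (F : Finset (Fin n) → Fin n → M) :
    ∑ J ∈ Finset.powersetCard (k + 1) (Finset.univ : Finset (Fin n)), ∑ m ∈ J, F (J.erase m) m =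
      ∑ T ∈ Finset.powersetCard k (Finset.univ : Finset (Fin n)), ∑ z ∈ Tᶜ, F T z := by
  rw [Finset.sum_sigma', Finset.sum_sigma']
  refine Finset.sum_bij' (fun Jm _ => ⟨Jm.1.erase Jm.2, Jm.2⟩) (fun Tz _ => ⟨insert Tz.2 Tz.1, Tz.2⟩)
    ?_ ?_ ?_ ?_ ?_
  · rintro ⟨J, m⟩ h
    simp only [Finset.mem_sigma, Finset.mem_powersetCard, Finset.subset_univ, true_and] at h ⊢
    refine ⟨?_, by simp⟩
    rw [Finset.card_erase_of_mem h.2, h.1]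
    rfl
  · rintro ⟨T, z⟩ h
    simp only [Finset.mem_sigma, Finset.mem_powersetCard, Finset.subset_univ, true_and,
      Finset.mem_compl] at h ⊢
    refine ⟨?_, Finset.mem_insert_self z T⟩
    rw [Finset.card_insert_of_notMem h.2, h.1]
  · rintro ⟨J, m⟩ h
    simp only [Finset.mem_sigma, Finset.mem_powersetCard, Finset.subset_univ, true_and] at h
    simp only [Finset.insert_erase h.2]
  · rintro ⟨T, z⟩ h
    simp only [Finset.mem_sigma, Finset.mem_powersetCard, Finset.subset_univ, true_and,
      Finset.mem_compl] at h
    simp only [Finset.erase_insert h.2]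
  · rintro ⟨J, m⟩ _
    rfl

/-! #### The `3`-cycles of a `4`-set, face by face -/

/-- A value of `Fin.succAbove` on `Fin 4`. [folklore] -/
theorem succAbove4_0_0 : Fin.succAbove (0 : Fin 4) (0 : Fin 3) = 1 := by decide
/-- A value of `Fin.succAbove` on `Fin 4`. [folklore] -/
theorem succAbove4_0_1 : Fin.succAbove (0 : Fin 4) (1 : Fin 3) = 2 := by decide
/-- A value of `Fin.succAbove` on `Fin 4`. [folklore] -/
theorem succAbove4_0_2 : Fin.succAbove (0 : Fin 4) (2 : Fin 3) = 3 := by decide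
/-- A value of `Fin.succAbove` on `Fin 4`. [folklore] -/
theorem succAbove4_1_0 : Fin.succAbove (1 : Fin 4) (0 : Fin 3) = 0 := by decide
/-- A value of `Fin.succAbove` on `Fin 4`. [folklore] -/
theorem succAbove4_1_1 : Fin.succAbove (1 : Fin 4) (1 : Fin 3) = 2 := by decide
/-- A value of `Fin.succAbove` on `Fin 4`. [folklore] -/
theorem succAbove4_1_2 : Fin.succAbove (1 : Fin 4) (2 : Fin 3) = 3 := by decide
/-- A value of `Fin.succAbove` on `Fin 4`. [folklore] -/
theorem succAbove4_2_0 : Fin.succAbove (2 : Fin 4) (0 : Fin 3) = 0 := by decide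
/-- A value of `Fin.succAbove` on `Fin 4`. [folklore] -/
theorem succAbove4_2_1 : Fin.succAbove (2 : Fin 4) (1 : Fin 3) = 1 := by decide
/-- A value of `Fin.succAbove` on `Fin 4`. [folklore] -/
theorem succAbove4_2_2 : Fin.succAbove (2 : Fin 4) (2 : Fin 3) = 3 := by decide
/-- A value of `Fin.succAbove` on `Fin 4`. [folklore] -/
theorem succAbove4_3_0 : Fin.succAbove (3 : Fin 4) (0 : Fin 3) = 0 := by decide
/-- A value of `Fin.succAbove` on `Fin 4`. [folklore] -/
theorem succAbove4_3_1 : Fin.succAbove (3 : Fin 4) (1 : Fin 3) = 1 := by decide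
/-- A value of `Fin.succAbove` on `Fin 4`. [folklore] -/
theorem succAbove4_3_2 : Fin.succAbove (3 : Fin 4) (2 : Fin 3) = 2 := by decide

/-- **The eight `3`-cycles of `Fin 4` are the `3`-cycles of its four `3`-faces.** [folklore] -/
theorem sum_embAlg_succAbove_R3 :
    ∑ m : Fin 4, embAlg (Fin.succAboveEmb m) R3 = setSum threeCycleSet := by
  rw [Fin.sum_univ_four, setSum_threeCycleSet, R3]
  simp only [map_add, embAlg_of_swap_mul_swap, Fin.coe_succAboveEmb, succAbove4_0_0, succAbove4_0_1, succAbove4_0_2, succAbove4_1_0, succAbove4_1_1, succAbove4_1_2, succAbove4_2_0, succAbove4_2_1, succAbove4_2_2, succAbove4_3_0, succAbove4_3_1, succAbove4_3_2]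
  abel

/-- The enumeration of `J ∖ ι(m)` is the enumeration of `J` composed with the face map. [folklore] -/
theorem orderEmbOfFin_erase {J : Finset (Fin n)} (hJ : J.card = 4) (m : Fin 4)
    (h3 : (J.erase (J.orderEmbOfFin hJ m)).card = 3) :
    ((J.erase (J.orderEmbOfFin hJ m)).orderEmbOfFin h3).toEmbedding =
      (Fin.succAboveEmb m).trans (J.orderEmbOfFin hJ).toEmbedding := by
  have key : ((Fin.succAboveOrderEmb m).trans (J.orderEmbOfFin hJ) : Fin 3 ↪o Fin n) =
      (J.erase (J.orderEmbOfFin hJ m)).orderEmbOfFin h3 := by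
    refine Finset.orderEmbOfFin_unique' h3 fun x => ?_
    simp only [RelEmbedding.coe_trans, Function.comp_apply, Finset.mem_erase]
    refine ⟨fun h => Fin.succAbove_ne m x ((J.orderEmbOfFin hJ).injective h), Finset.orderEmbOfFin_mem _ _ _⟩
  rw [← key]
  ext x
  rfl

/-- **`∑_{m ∈ J} R^{J∖m} = ι_J(∑ 3-cycles of 𝔖₄)`** for a `4`-set `J`. [cite: CaputoLiggettRichthammer2010, §3.2 Lemma 3.1 (b)] -/
theorem sum_octR_erase {J : Finset (Fin n)} (hJ : J.card = 4) :
    ∑ m ∈ J, octR (J.erase m) = embAlg (J.orderEmbOfFin hJ).toEmbedding (setSum threeCycleSet) := by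
  have step1 : ∑ m ∈ J, octR (J.erase m) = ∑ m' : Fin 4, octR (J.erase (J.orderEmbOfFin hJ m')) := by
    have h := Finset.sum_map (Finset.univ : Finset (Fin 4)) (J.orderEmbOfFin hJ).toEmbedding
      (fun m => octR (J.erase m))
    rw [Finset.map_orderEmbOfFin_univ] at h
    exact h
  rw [step1, ← sum_embAlg_succAbove_R3, map_sum]
  refine Finset.sum_congr rfl fun m' _ => ?_
  have h3 : (J.erase (J.orderEmbOfFin hJ m')).card = 3 := by
    rw [Finset.card_erase_of_mem (Finset.orderEmbOfFin_mem J hJ m'), hJ]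
  rw [octR_eq h3, embAlg_embAlg, orderEmbOfFin_erase hJ m' h3]

/-! #### Assembly of Lemma 3.1 -/

/-- `P^J − TC^J = A^J − 2·1` for a `4`-set (`2(𝟙_V − 1) − (𝟙_{𝔄₄} − 𝟙_V) = 3𝟙_V − 𝟙_{𝔄₄} − 2`).
[cite: CaputoLiggettRichthammer2010, §3.2 Lemma 3.1] -/
theorem octP_sub_octTC {J : Finset (Fin n)} (hJ : J.card = 4) :
    octP J - octTC J = octAset J - (2 : ℂ) • 1 := by
  rw [octP, dif_pos hJ, octTC, dif_pos hJ, sum_six4_eq, octAset_eq hJ, octA, A4, E4_expand]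
  simp only [map_smul, map_sub, map_add, map_one]
  module

/-- The `4`-set part of `Θ²`. [cite: CaputoLiggettRichthammer2010, §3.2 Lemma 3.1 (a)] -/
theorem sum_fib_four_eq (C : Fin n → ℝ) {J : Finset (Fin n)} (hJ : J.card = 4) :
    ∑ pq ∈ fib J, ((C pq.1.1 * C pq.1.2 * (C pq.2.1 * C pq.2.2) : ℝ) : ℂ) •
        MonoidAlgebra.of ℂ _ (swap pq.1.1 pq.1.2 * swap pq.2.1 pq.2.2) =
      ((∏ v ∈ J, C v : ℝ) : ℂ) • octP J := by
  rw [sum_fib_four C hJ, octP, dif_pos hJ]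

/-- **CLR Lemma 3.1 (the correction matrix):**
`Θ² = (∑_{u<v} (c_uc_v)² − 2 ∑_J c_J) · 1 + ∑_{|J|=4} c_J A^J` in `ℂ[𝔖ₙ]`, for rates with
`∑_v c_v = 0` (CLR: "`C'(n) = c²I − XᵗX = ∑_{J ⊂ V: |J|=4} −c_J A^J(n)`"; the scalar is identified
with `c²` in `theta_sq_scalar`). [cite: CaputoLiggettRichthammer2010, §3.2 Lemma 3.1] -/
theorem theta_mul_theta (C : Fin n → ℝ) (hC : ∑ v, C v = 0) :
    theta C * theta C =
      (((∑ p ∈ prs n, (C p.1 * C p.2) ^ 2) -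
          2 * ∑ J ∈ Finset.powersetCard 4 (Finset.univ : Finset (Fin n)), ∏ v ∈ J, C v : ℝ) : ℂ) • 1 +
      ∑ J ∈ Finset.powersetCard 4 (Finset.univ : Finset (Fin n)), ((∏ v ∈ J, C v : ℝ) : ℂ) • octAset J := by
  classical
  set F : (Fin n × Fin n) × (Fin n × Fin n) → MonoidAlgebra ℂ (Perm (Fin n)) := fun pq =>
    ((C pq.1.1 * C pq.1.2 * (C pq.2.1 * C pq.2.2) : ℝ) : ℂ) •
      MonoidAlgebra.of ℂ _ (swap pq.1.1 pq.1.2 * swap pq.2.1 pq.2.2) with hF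
  rw [theta_mul_theta_expand]
  change ∑ pq ∈ prs n ×ˢ prs n, F pq = _
  -- split off the diagonal
  rw [← Finset.sum_filter_add_sum_filter_not _ (fun pq => pq.1 = pq.2)]
  have hdiag : ∑ pq ∈ (prs n ×ˢ prs n).filter (fun pq => pq.1 = pq.2), F pq =
      ((∑ p ∈ prs n, (C p.1 * C p.2) ^ 2 : ℝ) : ℂ) • (1 : MonoidAlgebra ℂ (Perm (Fin n))) := by
    rw [Finset.sum_filter, Finset.sum_product, Complex.ofReal_sum, Finset.sum_smul]
    refine Finset.sum_congr rfl fun p hp => ?_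
    rw [Finset.sum_ite_eq, if_pos hp, hF]
    simp only [swap_mul_self, map_one, Complex.ofReal_pow, Complex.ofReal_mul]
    congr 1
    ring
  -- the off-diagonal part, fibred by the support
  set off := (prs n ×ˢ prs n).filter (fun pq => ¬ pq.1 = pq.2) with hoff
  have hoff4 : ∀ pq ∈ off.filter (fun pq => (supp4 pq).card = 4),
      supp4 pq ∈ Finset.powersetCard 4 (Finset.univ : Finset (Fin n)) := by
    intro pq hpq
    rw [Finset.mem_powersetCard]
    exact ⟨Finset.subset_univ _, (Finset.mem_filter.mp hpq).2⟩
  have hoff3 : ∀ pq ∈ off.filter (fun pq => ¬ (supp4 pq).card = 4),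
      supp4 pq ∈ Finset.powersetCard 3 (Finset.univ : Finset (Fin n)) := by
    intro pq hpq
    rw [Finset.mem_filter, hoff, Finset.mem_filter, Finset.mem_product] at hpq
    rw [Finset.mem_powersetCard]
    refine ⟨Finset.subset_univ _, ?_⟩
    have h3 := three_le_card_supp4 (pq := pq) hpq.1.1.1 hpq.1.1.2 hpq.1.2
    have h4 := card_supp4_le pq
    omega
  have hfib4 : ∀ J ∈ Finset.powersetCard 4 (Finset.univ : Finset (Fin n)),
      (off.filter (fun pq => (supp4 pq).card = 4)).filter (fun pq => supp4 pq = J) = fib J := by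
    intro J hJ
    rw [Finset.mem_powersetCard] at hJ
    ext pq
    simp only [hoff, fib, Finset.mem_filter, Finset.mem_product]
    constructor
    · rintro ⟨⟨⟨hp, hne⟩, -⟩, hs⟩
      exact ⟨hp, hne, hs⟩
    · rintro ⟨hp, hne, hs⟩
      exact ⟨⟨⟨hp, hne⟩, by rw [hs, hJ.2]⟩, hs⟩
  have hfib3 : ∀ T ∈ Finset.powersetCard 3 (Finset.univ : Finset (Fin n)),
      (off.filter (fun pq => ¬ (supp4 pq).card = 4)).filter (fun pq => supp4 pq = T) = fib T := by
    intro T hT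
    rw [Finset.mem_powersetCard] at hT
    ext pq
    simp only [hoff, fib, Finset.mem_filter, Finset.mem_product]
    constructor
    · rintro ⟨⟨⟨hp, hne⟩, -⟩, hs⟩
      exact ⟨hp, hne, hs⟩
    · rintro ⟨hp, hne, hs⟩
      exact ⟨⟨⟨hp, hne⟩, by rw [hs, hT.2]; decide⟩, hs⟩
  have hpart4 : ∑ pq ∈ off.filter (fun pq => (supp4 pq).card = 4), F pq =
      ∑ J ∈ Finset.powersetCard 4 (Finset.univ : Finset (Fin n)), ((∏ v ∈ J, C v : ℝ) : ℂ) • octP J := by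
    rw [← Finset.sum_fiberwise_of_maps_to hoff4]
    refine Finset.sum_congr rfl fun J hJ => ?_
    rw [hfib4 J hJ, hF]
    exact sum_fib_four_eq C (Finset.mem_powersetCard.mp hJ).2
  have hpart3 : ∑ pq ∈ off.filter (fun pq => ¬ (supp4 pq).card = 4), F pq =
      -∑ J ∈ Finset.powersetCard 4 (Finset.univ : Finset (Fin n)), ((∏ v ∈ J, C v : ℝ) : ℂ) • octTC J := by
    rw [← Finset.sum_fiberwise_of_maps_to hoff3]
    -- evaluate each fibre
    have step1 : ∑ T ∈ Finset.powersetCard 3 (Finset.univ : Finset (Fin n)),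
        ∑ pq ∈ (off.filter (fun pq => ¬ (supp4 pq).card = 4)).filter (fun pq => supp4 pq = T), F pq =
        ∑ T ∈ Finset.powersetCard 3 (Finset.univ : Finset (Fin n)),
          -∑ z ∈ Tᶜ, ((∏ v ∈ insert z T, C v : ℝ) : ℂ) • octR T := by
      refine Finset.sum_congr rfl fun T hT => ?_
      have hT3 : T.card = 3 := (Finset.mem_powersetCard.mp hT).2
      rw [hfib3 T hT, hF, sum_fib_three_eq C hT3]
      -- `s_T = -∑_{z ∉ T} c_z`
      have hs : ∑ v ∈ T, C v = -∑ z ∈ Tᶜ, C z := by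
        have := Finset.sum_add_sum_compl T C
        rw [hC] at this
        linarith
      rw [hs, mul_neg, Complex.ofReal_neg, neg_smul, Finset.mul_sum, Complex.ofReal_sum, Finset.sum_smul,
        ← Finset.sum_neg_distrib, ← Finset.sum_neg_distrib]
      refine Finset.sum_congr rfl fun z hz => ?_
      rw [Finset.prod_insert (Finset.mem_compl.mp hz), mul_comm]
    have hre := sum_powersetCard_succ_erase (M := MonoidAlgebra ℂ (Perm (Fin n))) 3
      (fun T z => ((∏ v ∈ insert z T, C v : ℝ) : ℂ) • octR T)
    rw [step1, Finset.sum_neg_distrib, neg_inj, ← hre]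
    refine Finset.sum_congr rfl fun J hJ => ?_
    have hJ4 : J.card = 4 := (Finset.mem_powersetCard.mp hJ).2
    rw [Finset.sum_congr rfl fun m hm => by rw [Finset.insert_erase hm], ← Finset.smul_sum,
      sum_octR_erase hJ4, octTC, dif_pos hJ4]
  rw [hdiag, ← Finset.sum_filter_add_sum_filter_not off (fun pq => (supp4 pq).card = 4), hpart4, hpart3,
    ← sub_eq_add_neg, ← Finset.sum_sub_distrib]
  have hJ : ∀ J ∈ Finset.powersetCard 4 (Finset.univ : Finset (Fin n)),
      ((∏ v ∈ J, C v : ℝ) : ℂ) • octP J - ((∏ v ∈ J, C v : ℝ) : ℂ) • octTC J =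
      ((∏ v ∈ J, C v : ℝ) : ℂ) • octAset J - (((∏ v ∈ J, C v : ℝ) : ℂ) * 2) • (1 : MonoidAlgebra ℂ (Perm (Fin n))) := by
    intro J hJ
    rw [← smul_sub, octP_sub_octTC (Finset.mem_powersetCard.mp hJ).2, smul_sub, smul_smul]
  rw [Finset.sum_congr rfl hJ, Finset.sum_sub_distrib, ← Finset.sum_smul, ← Finset.sum_mul]
  push_cast
  module

/-- **The scalar in Lemma 3.1 is `c²`**: applying both sides of `theta_mul_theta` to a constant
function (on which every `A^J` vanishes, `3·|V| − |𝔄₄| = 0`, and `Θ` acts by `∑_{u<v} c_uc_v = −c`)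
identifies `∑_{u<v}(c_uc_v)² − 2∑_J c_J = c²` (CLR Lemma 3.1 (c), there by the algebraic identity
`(∑_{i<j} c_ic_j)² − ∑_{i<j}(c_ic_j)² = −2 ∑_{i<j<k<l} c_ic_jc_kc_l`).
[cite: CaputoLiggettRichthammer2010, §3.2 Lemma 3.1 (c)] -/
theorem theta_sq_scalar (C : Fin n → ℝ) (hC : ∑ v, C v = 0) :
    (∑ p ∈ prs n, (C p.1 * C p.2) ^ 2) -
        2 * ∑ J ∈ Finset.powersetCard 4 (Finset.univ : Finset (Fin n)), ∏ v ∈ J, C v =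
      (∑ p ∈ prs n, C p.1 * C p.2) ^ 2 := by
  -- act on the constant function `1` and evaluate at the identity permutation
  set κ : ℝ := (∑ p ∈ prs n, (C p.1 * C p.2) ^ 2) -
    2 * ∑ J ∈ Finset.powersetCard 4 (Finset.univ : Finset (Fin n)), ∏ v ∈ J, C v with hκ
  set s : ℝ := ∑ p ∈ prs n, C p.1 * C p.2 with hs
  -- `Θ` acts on constants by the scalar `s`
  have hθ1 : regOp n (theta C) (fun _ => (1 : ℂ)) = fun _ => (s : ℂ) := by
    funext τ
    rw [regOp_theta_apply, hs, Complex.ofReal_sum]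
    exact Finset.sum_congr rfl fun p _ => by rw [mul_one]
  have hcs : (fun _ : Perm (Fin n) => (s : ℂ)) = (s : ℂ) • (fun _ : Perm (Fin n) => (1 : ℂ)) := by
    funext τ
    simp
  have hθs : regOp n (theta C) (fun _ => (s : ℂ)) = (s : ℂ) • fun _ => (s : ℂ) := by
    rw [hcs, map_smul, hθ1, ← hcs]
  -- `𝟙_S` acts on constants by `|S|`, so every `A^J` kills them (`3·4 − 12 = 0`)
  have hconst : ∀ S : Finset (Perm (Fin n)),
      regOp n (setSum S) (fun _ => (1 : ℂ)) = fun _ => (S.card : ℂ) := by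
    intro S
    funext τ
    rw [regOp_setSum_apply, Finset.sum_const, nsmul_eq_mul, mul_one]
  have hA : ∀ J : Finset (Fin n), J.card = 4 → regOp n (octAset J) (fun _ => (1 : ℂ)) = 0 := by
    intro J hJ4
    rw [octAset_eq hJ4, octA_eq, map_sub, map_smul, LinearMap.sub_apply, LinearMap.smul_apply, hconst,
      hconst, Finset.card_image_of_injective _ (Perm.viaEmbeddingHom_injective _),
      Finset.card_image_of_injective _ (Perm.viaEmbeddingHom_injective _), card_kleinSet, card_altSet]
    funext τ
    simp only [Pi.sub_apply, Pi.smul_apply, Pi.zero_apply, smul_eq_mul]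
    norm_num
  have hzero : (∑ J ∈ Finset.powersetCard 4 (Finset.univ : Finset (Fin n)),
      regOp n (((∏ v ∈ J, C v : ℝ) : ℂ) • octAset J)) (fun _ => (1 : ℂ)) = 0 := by
    rw [LinearMap.sum_apply]
    refine Finset.sum_eq_zero fun J hJ => ?_
    rw [map_smul, LinearMap.smul_apply, hA J (Finset.mem_powersetCard.mp hJ).2, smul_zero]
  have key := congrArg (fun a : MonoidAlgebra ℂ (Perm (Fin n)) => regOp n a (fun _ => (1 : ℂ)) 1)
    (theta_mul_theta C hC)
  rw [map_mul, Module.End.mul_apply, hθ1, hθs, map_add, LinearMap.add_apply, map_smul,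
    LinearMap.smul_apply, map_one, Module.End.one_apply, map_sum, hzero] at key
  simp only [Pi.add_apply, Pi.smul_apply, Pi.zero_apply, smul_eq_mul, mul_one, add_zero] at key
  -- `key : s * s = κ` in `ℂ`
  have hκs : (κ : ℂ) = ((s ^ 2 : ℝ) : ℂ) := by
    rw [Complex.ofReal_pow, sq, key]
  exact Complex.ofReal_injective hκs

end Lemma31


/-! ### CLR Lemma 3.4: `C'(n) = ∑_J (−c_J) A^J ≥ 0`, whence `‖Θ g‖ ≤ c ‖g‖` -/

section Lemma34

variable {n : ℕ}

/-- The quadratic form `q_J(g) = Re⟪g, λ(A^J) g⟫` of a finite set `J` (zero unless `|J| = 4`).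
[cite: CaputoLiggettRichthammer2010, §3.3 Lemma 3.4] -/
def qset (J : Finset (Fin n)) (g : Perm (Fin n) → ℂ) : ℝ := (l2Inner g (regOp n (octAset J) g)).re

/-- Unfolding lemma for `qset`. [folklore] -/
theorem qset_def (J : Finset (Fin n)) (g : Perm (Fin n) → ℂ) :
    qset J g = (l2Inner g (regOp n (octAset J) g)).re := rfl

/-- The image of an embedding of `Fin 4` has four elements. [folklore] -/
theorem card_eq_four_of_range_eq {J : Finset (Fin n)} {ι : Fin 4 ↪ Fin n} (h : Set.range ι = ↑J) :
    J.card = 4 := by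
  have himg : Finset.univ.image ι = J := by
    ext x
    rw [Finset.mem_image, ← Finset.mem_coe, ← h, Set.mem_range]
    constructor
    · rintro ⟨a, -, rfl⟩; exact ⟨a, rfl⟩
    · rintro ⟨a, rfl⟩; exact ⟨a, Finset.mem_univ _, rfl⟩
  rw [← himg, Finset.card_image_of_injective _ ι.injective, Finset.card_univ, Fintype.card_fin]

/-- `q_J = q_ι` for any enumeration `ι` of `J`. [cite: CaputoLiggettRichthammer2010, §3.2] -/
theorem qset_eq_qA {J : Finset (Fin n)} {ι : Fin 4 ↪ Fin n} (h : Set.range ι = ↑J) (g : Perm (Fin n) → ℂ) :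
    qset J g = qA ι g := by
  have hJ : J.card = 4 := card_eq_four_of_range_eq h
  rw [qset, octAset_eq hJ, ← qA_def]
  apply qA_eq_of_range_eq
  rw [h]
  exact Finset.range_orderEmbOfFin J hJ

/-- `q_J ≥ 0`. [cite: CaputoLiggettRichthammer2010, §3.2 Lemma 3.2] -/
theorem qset_nonneg (J : Finset (Fin n)) (g : Perm (Fin n) → ℂ) : 0 ≤ qset J g := by
  rw [qset, octAset]
  split_ifs with h
  · exact re_l2Inner_regOp_octA_nonneg _ g
  · simp [l2Inner]

/-- The embedding `Fin 5 ↪ Fin n` sending `0 ↦ x₀` and `i⁺ ↦ ι i`, for `ι` avoiding `x₀`. [folklore] -/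
def consEmb (x₀ : Fin n) (ι : Fin 4 ↪ Fin n) (h0 : x₀ ∉ Set.range ι) : Fin 5 ↪ Fin n :=
  ⟨Fin.cons x₀ ι, Fin.cons_injective_iff.mpr ⟨h0, ι.injective⟩⟩

/-- `consEmb x₀ ι h0 0 = x₀`. [folklore] -/
theorem consEmb_zero (x₀ : Fin n) (ι : Fin 4 ↪ Fin n) (h0 : x₀ ∉ Set.range ι) : consEmb x₀ ι h0 0 = x₀ := by
  simp [consEmb]

/-- `consEmb x₀ ι h0 i⁺ = ι i`. [folklore] -/
theorem consEmb_succ (x₀ : Fin n) (ι : Fin 4 ↪ Fin n) (h0 : x₀ ∉ Set.range ι) (i : Fin 4) :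
    consEmb x₀ ι h0 i.succ = ι i := by
  simp [consEmb]

/-- The `0`-face of `consEmb x₀ ι` is `ι`. [folklore] -/
theorem range_face_zero_consEmb (x₀ : Fin n) (ι : Fin 4 ↪ Fin n) (h0 : x₀ ∉ Set.range ι) :
    Set.range ((faceEmb 0).trans (consEmb x₀ ι h0)) = Set.range ι := by
  ext x
  simp only [Set.mem_range, Function.Embedding.trans_apply, faceEmb_apply, Fin.succAbove_zero,
    consEmb_succ]

/-- `succAbove (k+1) 0 = 0`. [folklore] -/
theorem succAbove_succ_zero (k : Fin 4) : Fin.succAbove k.succ (0 : Fin 4) = 0 := by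
  rw [Fin.succAbove_of_castSucc_lt]
  · rfl
  · rw [Fin.castSucc_zero]
    exact Fin.succ_pos k

/-- The other faces of `consEmb x₀ ι` are `{x₀} ∪ (J ∖ ι k)`. [folklore] -/
theorem range_face_succ_consEmb (x₀ : Fin n) (ι : Fin 4 ↪ Fin n) (h0 : x₀ ∉ Set.range ι) (k : Fin 4)
    {J : Finset (Fin n)} (hJ : Set.range ι = ↑J) :
    Set.range ((faceEmb k.succ).trans (consEmb x₀ ι h0)) = ↑(insert x₀ (J.erase (ι k))) := by
  ext x
  simp only [Set.mem_range, Function.Embedding.trans_apply, faceEmb_apply, Finset.coe_insert,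
    Finset.coe_erase, Set.mem_insert_iff, Set.mem_sdiff, Finset.mem_coe, Set.mem_singleton_iff]
  constructor
  · rintro ⟨a, rfl⟩
    refine Fin.cases ?_ (fun b => ?_) a
    · left
      rw [succAbove_succ_zero, consEmb_zero]
    · right
      rw [Fin.succ_succAbove_succ, consEmb_succ]
      refine ⟨?_, fun h => Fin.succAbove_ne k b (ι.injective h)⟩
      rw [← Finset.mem_coe, ← hJ]
      exact ⟨_, rfl⟩
  · rintro (rfl | ⟨hxJ, hxk⟩)
    · exact ⟨0, by rw [succAbove_succ_zero, consEmb_zero]⟩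
    · have hx : x ∈ Set.range ι := by rw [hJ]; exact hxJ
      obtain ⟨b, rfl⟩ := hx
      have hbk : ι b ≠ ι k := hxk
      obtain ⟨c, hc⟩ := Fin.exists_succAbove_eq (fun h => hbk (congrArg ι h))
      exact ⟨c.succ, by rw [Fin.succ_succAbove_succ, consEmb_succ, hc]⟩

/-- Summing over a `4`-set through its enumeration. [folklore] -/
theorem sum_eq_sum_orderEmbOfFin {M : Type*} [AddCommMonoid M] {J : Finset (Fin n)} (hJ : J.card = 4)
    (F : Fin n → M) : ∑ k ∈ J, F k = ∑ i : Fin 4, F (J.orderEmbOfFin hJ i) := by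
  have h := Finset.sum_map (Finset.univ : Finset (Fin 4)) (J.orderEmbOfFin hJ).toEmbedding F
  rw [Finset.map_orderEmbOfFin_univ] at h
  exact h

/-- **The face inequality for sets**: for a `4`-set `J ∌ x₀`,
`q_J ≤ ∑_{k ∈ J} q_{{x₀} ∪ (J∖k)}` (from `B^{J ∪ {x₀}} ≥ 0`).
[cite: CaputoLiggettRichthammer2010, §3.3 Lemma 3.4 (proof, via (propB))] -/
theorem qset_le_sum_qset_insert (x₀ : Fin n) {J : Finset (Fin n)} (hJ : J.card = 4) (h0 : x₀ ∉ J)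
    (g : Perm (Fin n) → ℂ) :
    qset J g ≤ ∑ k ∈ J, qset (insert x₀ (J.erase k)) g := by
  set ι : Fin 4 ↪ Fin n := (J.orderEmbOfFin hJ).toEmbedding with hι
  have hrange : Set.range ι = ↑J := Finset.range_orderEmbOfFin J hJ
  have h0' : x₀ ∉ Set.range ι := by rw [hrange]; exact h0
  have key := qA_face_zero_le (consEmb x₀ ι h0') g
  rw [← qset_eq_qA (by rw [range_face_zero_consEmb, hrange]) g] at key
  refine key.trans (le_of_eq ?_)
  rw [sum_eq_sum_orderEmbOfFin hJ]
  refine Finset.sum_congr rfl fun i _ => ?_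
  exact (qset_eq_qA (range_face_succ_consEmb x₀ ι h0' i hrange) g).symm

/-- Regrouping `(J ∌ x₀, k ∈ J) ↔ (J' ∋ x₀, z ∉ J')` with `J' = {x₀} ∪ (J∖k)`, `z = k`. [folklore] -/
theorem sum_notMem_mem_eq_sum_mem_notMem {M : Type*} [AddCommMonoid M] (x₀ : Fin n)
    (F : Finset (Fin n) → Fin n → M) :
    ∑ J ∈ (Finset.powersetCard 4 (Finset.univ : Finset (Fin n))).filter (fun J => x₀ ∉ J),
        ∑ k ∈ J, F (insert x₀ (J.erase k)) k =
      ∑ J' ∈ (Finset.powersetCard 4 (Finset.univ : Finset (Fin n))).filter (fun J' => x₀ ∈ J'),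
        ∑ z ∈ J'ᶜ, F J' z := by
  rw [Finset.sum_sigma', Finset.sum_sigma']
  refine Finset.sum_bij' (fun Jk _ => (⟨insert x₀ (Jk.1.erase Jk.2), Jk.2⟩ : Σ _ : Finset (Fin n), Fin n))
    (fun Jz _ => (⟨insert Jz.2 (Jz.1.erase x₀), Jz.2⟩ : Σ _ : Finset (Fin n), Fin n)) ?_ ?_ ?_ ?_ ?_
  · rintro ⟨J, k⟩ h
    obtain ⟨hJ, hk⟩ := Finset.mem_sigma.mp h
    obtain ⟨hJ4, hJ0⟩ := Finset.mem_filter.mp hJ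
    have hJ4' : J.card = 4 := (Finset.mem_powersetCard.mp hJ4).2
    simp only at hk
    have hk0 : k ≠ x₀ := fun e => hJ0 (e ▸ hk)
    have hx : x₀ ∉ J.erase k := fun e => hJ0 (Finset.mem_of_mem_erase e)
    refine Finset.mem_sigma.mpr ⟨Finset.mem_filter.mpr ⟨?_, Finset.mem_insert_self _ _⟩, ?_⟩
    · rw [Finset.mem_powersetCard]
      refine ⟨Finset.subset_univ _, ?_⟩
      rw [Finset.card_insert_of_notMem hx, Finset.card_erase_of_mem hk, hJ4']
    · rw [Finset.mem_compl, Finset.mem_insert, not_or]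
      exact ⟨hk0, Finset.notMem_erase k J⟩
  · rintro ⟨J', z⟩ h
    obtain ⟨hJ', hz⟩ := Finset.mem_sigma.mp h
    obtain ⟨hJ4, hJ0⟩ := Finset.mem_filter.mp hJ'
    have hJ4' : J'.card = 4 := (Finset.mem_powersetCard.mp hJ4).2
    simp only [Finset.mem_compl] at hz
    have hz0 : z ≠ x₀ := fun e => hz (e ▸ hJ0)
    have hzJ : z ∉ J'.erase x₀ := fun e => hz (Finset.mem_of_mem_erase e)
    refine Finset.mem_sigma.mpr ⟨Finset.mem_filter.mpr ⟨?_, ?_⟩, ?_⟩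
    · rw [Finset.mem_powersetCard]
      refine ⟨Finset.subset_univ _, ?_⟩
      rw [Finset.card_insert_of_notMem hzJ, Finset.card_erase_of_mem hJ0, hJ4']
    · rw [Finset.mem_insert, not_or]
      exact ⟨hz0.symm, Finset.notMem_erase x₀ J'⟩
    · exact Finset.mem_insert_self _ _
  · rintro ⟨J, k⟩ h
    obtain ⟨hJ, hk⟩ := Finset.mem_sigma.mp h
    obtain ⟨-, hJ0⟩ := Finset.mem_filter.mp hJ
    simp only at hk
    have hx : x₀ ∉ J.erase k := fun e => hJ0 (Finset.mem_of_mem_erase e)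
    simp only [Finset.erase_insert hx, Finset.insert_erase hk]
  · rintro ⟨J', z⟩ h
    obtain ⟨hJ', hz⟩ := Finset.mem_sigma.mp h
    obtain ⟨-, hJ0⟩ := Finset.mem_filter.mp hJ'
    simp only [Finset.mem_compl] at hz
    have hzJ : z ∉ J'.erase x₀ := fun e => hz (Finset.mem_of_mem_erase e)
    simp only [Finset.erase_insert hzJ, Finset.insert_erase hJ0]
  · rintro ⟨J, k⟩ _
    rfl

/-- **CLR Lemma 3.4 (the correction matrix is non-negative):** for rates with `∑_v c_v = 0` and
`c_v ≥ 0` for `v ≠ x₀`, `∑_{|J|=4} c_J q_J(g) ≤ 0`, i.e. `⟨g, C'(n) g⟩ = ∑_J (−c_J) ⟨g, A^J g⟩ ≥ 0`.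
[cite: CaputoLiggettRichthammer2010, §3.3 Lemma 3.4] -/
theorem sum_weight_qset_nonpos (x₀ : Fin n) (C : Fin n → ℝ) (hC : ∑ v, C v = 0)
    (hpos : ∀ v, v ≠ x₀ → 0 ≤ C v) (g : Perm (Fin n) → ℂ) :
    ∑ J ∈ Finset.powersetCard 4 (Finset.univ : Finset (Fin n)), (∏ v ∈ J, C v) * qset J g ≤ 0 := by
  classical
  rw [← Finset.sum_filter_add_sum_filter_not (Finset.powersetCard 4 (Finset.univ : Finset (Fin n)))
    (fun J => x₀ ∈ J)]
  -- nonnegativity of products avoiding `x₀`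
  have hprod : ∀ S : Finset (Fin n), x₀ ∉ S → 0 ≤ ∏ v ∈ S, C v := fun S hS =>
    Finset.prod_nonneg fun v hv => hpos v fun e => hS (e ▸ hv)
  -- the sets avoiding `x₀`: bound by the face inequality and regroup
  have h1 : ∑ J ∈ (Finset.powersetCard 4 (Finset.univ : Finset (Fin n))).filter (fun J => x₀ ∉ J),
      (∏ v ∈ J, C v) * qset J g ≤
      ∑ J' ∈ (Finset.powersetCard 4 (Finset.univ : Finset (Fin n))).filter (fun J' => x₀ ∈ J'),
        ∑ z ∈ J'ᶜ, (∏ v ∈ J'.erase x₀, C v) * C z * qset J' g := by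
    calc ∑ J ∈ (Finset.powersetCard 4 (Finset.univ : Finset (Fin n))).filter (fun J => x₀ ∉ J),
          (∏ v ∈ J, C v) * qset J g
        ≤ ∑ J ∈ (Finset.powersetCard 4 (Finset.univ : Finset (Fin n))).filter (fun J => x₀ ∉ J),
            ∑ k ∈ J, (∏ v ∈ J, C v) * qset (insert x₀ (J.erase k)) g := by
          refine Finset.sum_le_sum fun J hJ => ?_
          rw [Finset.mem_filter, Finset.mem_powersetCard] at hJ
          rw [← Finset.mul_sum]
          exact mul_le_mul_of_nonneg_left (qset_le_sum_qset_insert x₀ hJ.1.2 hJ.2 g) (hprod J hJ.2)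
      _ = ∑ J ∈ (Finset.powersetCard 4 (Finset.univ : Finset (Fin n))).filter (fun J => x₀ ∉ J),
            ∑ k ∈ J, (∏ v ∈ (insert x₀ (J.erase k)).erase x₀, C v) * C k *
              qset (insert x₀ (J.erase k)) g := by
          refine Finset.sum_congr rfl fun J hJ => Finset.sum_congr rfl fun k hk => ?_
          rw [Finset.mem_filter] at hJ
          have hx : x₀ ∉ J.erase k := fun e => hJ.2 (Finset.mem_of_mem_erase e)
          rw [Finset.erase_insert hx, Finset.prod_erase_mul _ _ hk]
      _ = _ := sum_notMem_mem_eq_sum_mem_notMem x₀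
            (fun J' z => (∏ v ∈ J'.erase x₀, C v) * C z * qset J' g)
  refine (add_le_add_right h1 _).trans ?_
  rw [← Finset.sum_add_distrib]
  refine Finset.sum_nonpos fun J' hJ' => ?_
  rw [Finset.mem_filter, Finset.mem_powersetCard] at hJ'
  obtain ⟨⟨-, -⟩, hJ0⟩ := hJ'
  -- `c_{J'} = c_{x₀} ∏_{J'∖x₀} c` and `c_{x₀} = -∑_{v ≠ x₀} c_v`
  have hCJ : ∏ v ∈ J', C v = C x₀ * ∏ v ∈ J'.erase x₀, C v := (Finset.mul_prod_erase J' C hJ0).symm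
  have hC0 : C x₀ = -∑ v ∈ ({x₀} : Finset (Fin n))ᶜ, C v := by
    have := Finset.sum_add_sum_compl ({x₀} : Finset (Fin n)) C
    rw [Finset.sum_singleton, hC] at this
    linarith
  -- `∑_{v ≠ x₀} c_v = ∑_{z ∉ J'} c_z + ∑_{z ∈ J' ∖ x₀} c_z`
  have hsplit : ∑ v ∈ ({x₀} : Finset (Fin n))ᶜ, C v = ∑ z ∈ J'ᶜ, C z + ∑ z ∈ J'.erase x₀, C z := by
    have hdisj : Disjoint J'ᶜ (J'.erase x₀) := by
      rw [Finset.disjoint_left]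
      intro z hz hz'
      exact Finset.mem_compl.mp hz (Finset.mem_of_mem_erase hz')
    rw [← Finset.sum_union hdisj]
    congr 1
    ext z
    simp only [Finset.mem_compl, Finset.mem_singleton, Finset.mem_union, Finset.mem_erase]
    constructor
    · intro hzx
      by_cases hz : z ∈ J'
      · exact Or.inr ⟨hzx, hz⟩
      · exact Or.inl hz
    · rintro (hz | ⟨hzx, -⟩)
      · exact fun e => hz (e ▸ hJ0)
      · exact hzx
  rw [← Finset.sum_mul, ← Finset.mul_sum, hCJ, hC0, hsplit]
  have h2 : 0 ≤ ∏ v ∈ J'.erase x₀, C v := hprod _ (Finset.notMem_erase x₀ J')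
  have h3 : 0 ≤ ∑ z ∈ J'.erase x₀, C z := Finset.sum_nonneg fun z hz => hpos z (Finset.ne_of_mem_erase hz)
  have h4 := qset_nonneg J' g
  nlinarith [mul_nonneg (mul_nonneg h2 h3) h4]

/-- **`Re⟪g, Θ² g⟫ ≤ c² ‖g‖²`**, i.e. `C'(n) ≥ 0` (CLR (cor)): `‖X g‖ ≤ c‖g‖` for the odd-even block
`X` of `C`. [cite: CaputoLiggettRichthammer2010, §3.3 Lemma 3.4 with §3.1 (cor)] -/
theorem re_l2Inner_theta_theta_le (x₀ : Fin n) (C : Fin n → ℝ) (hC : ∑ v, C v = 0)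
    (hpos : ∀ v, v ≠ x₀ → 0 ≤ C v) (g : Perm (Fin n) → ℂ) :
    (l2Inner g (regOp n (theta C) (regOp n (theta C) g))).re ≤
      (∑ p ∈ prs n, C p.1 * C p.2) ^ 2 * l2NormSq g := by
  have hexp : regOp n (theta C) (regOp n (theta C) g) =
      (((∑ p ∈ prs n, C p.1 * C p.2) ^ 2 : ℝ) : ℂ) • g +
        ∑ J ∈ Finset.powersetCard 4 (Finset.univ : Finset (Fin n)),
          ((∏ v ∈ J, C v : ℝ) : ℂ) • regOp n (octAset J) g := by
    rw [← Module.End.mul_apply, ← map_mul, theta_mul_theta C hC, theta_sq_scalar C hC, map_add,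
      map_smul, map_sum, map_one, LinearMap.add_apply, LinearMap.smul_apply, Module.End.one_apply,
      LinearMap.sum_apply]
    congr 1
    refine Finset.sum_congr rfl fun J _ => ?_
    rw [map_smul, LinearMap.smul_apply]
  rw [hexp, l2Inner_add_right, l2Inner_smul_right, l2Inner_sum_right, Complex.add_re,
    Complex.re_ofReal_mul, l2Inner_self_re, Complex.re_sum]
  have hq : ∑ J ∈ Finset.powersetCard 4 (Finset.univ : Finset (Fin n)),
      (l2Inner g (((∏ v ∈ J, C v : ℝ) : ℂ) • regOp n (octAset J) g)).re =
      ∑ J ∈ Finset.powersetCard 4 (Finset.univ : Finset (Fin n)), (∏ v ∈ J, C v) * qset J g := by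
    refine Finset.sum_congr rfl fun J _ => ?_
    rw [l2Inner_smul_right, Complex.re_ofReal_mul, qset]
  rw [hq]
  have := sum_weight_qset_nonpos x₀ C hC hpos g
  linarith

end Lemma34

/-! ### Parity, and the proof of the octopus inequality -/

section Parity

variable {n : ℕ}

/-- **`λ(Θ)` is self-adjoint** (the matrix `C` is symmetric). [cite: CaputoLiggettRichthammer2010, §3 (defC)] -/
theorem l2Inner_theta_comm (C : Fin n → ℝ) (a b : Perm (Fin n) → ℂ) :
    l2Inner a (regOp n (theta C) b) = l2Inner (regOp n (theta C) a) b := by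
  rw [regOp_theta_eq, regOp_theta_eq, l2Inner_sum_right, l2Inner_sum_left]
  refine Finset.sum_congr rfl fun p _ => ?_
  rw [l2Inner_smul_right, l2Inner_smul_left, Complex.conj_ofReal,
    l2Inner_shift_right_of_mul_self _ _ (swap_mul_self p.1 p.2)]

/-- **`Re⟪f, λ(Θ) f⟫ = ∑_{u<v} c_uc_v Re⟪f, f((uv)·)⟫`.** [cite: CaputoLiggettRichthammer2010, §3 (octopus2)] -/
theorem re_l2Inner_theta (C : Fin n → ℝ) (f : Perm (Fin n) → ℂ) :
    (l2Inner f (regOp n (theta C) f)).re =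
      ∑ p ∈ prs n, C p.1 * C p.2 * (l2Inner f (fun τ => f (swap p.1 p.2 * τ))).re := by
  rw [regOp_theta_eq, l2Inner_sum_right, Complex.re_sum]
  refine Finset.sum_congr rfl fun p _ => ?_
  rw [l2Inner_smul_right, Complex.re_ofReal_mul]

/-- The even part of a function on `𝔖ₙ` (supported on even permutations). [folklore] -/
def evenPart (f : Perm (Fin n) → ℂ) : Perm (Fin n) → ℂ := fun τ => if Perm.sign τ = 1 then f τ else 0

/-- The odd part of a function on `𝔖ₙ` (supported on odd permutations). [folklore] -/
def oddPart (f : Perm (Fin n) → ℂ) : Perm (Fin n) → ℂ := fun τ => if Perm.sign τ = 1 then 0 else f τ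

/-- `f = f₊ + f₋`. [folklore] -/
theorem evenPart_add_oddPart (f : Perm (Fin n) → ℂ) : evenPart f + oddPart f = f := by
  funext τ
  simp only [Pi.add_apply, evenPart, oddPart]
  split_ifs <;> simp

/-- `‖f‖² = ‖f₊‖² + ‖f₋‖²`. [folklore] -/
theorem l2NormSq_evenPart_add (f : Perm (Fin n) → ℂ) :
    l2NormSq (evenPart f) + l2NormSq (oddPart f) = l2NormSq f := by
  rw [l2NormSq, l2NormSq, l2NormSq, ← Finset.sum_add_distrib]
  refine Finset.sum_congr rfl fun τ _ => ?_
  simp only [evenPart, oddPart]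
  split_ifs <;> simp

/-- A transposition from `prs` flips the sign. [folklore] -/
theorem sign_swap_mul_of_mem_prs {p : Fin n × Fin n} (hp : p ∈ prs n) (τ : Perm (Fin n)) :
    Perm.sign (swap p.1 p.2 * τ) = -Perm.sign τ := by
  rw [Perm.sign_mul, Perm.sign_swap (mem_prs.mp hp).ne, neg_one_mul]

/-- **`Θ` maps even functions to odd ones**: `⟪f₊, λ(Θ) f₊⟫ = 0` (CLR §3.1: "every transposition
takes even to odd permutations and vice versa, so `C` has the block structure …").
[cite: CaputoLiggettRichthammer2010, §3.1] -/
theorem l2Inner_evenPart_theta_evenPart (C : Fin n → ℝ) (f : Perm (Fin n) → ℂ) :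
    l2Inner (evenPart f) (regOp n (theta C) (evenPart f)) = 0 := by
  rw [l2Inner]
  refine Finset.sum_eq_zero fun τ _ => ?_
  rw [regOp_theta_apply]
  by_cases hτ : Perm.sign τ = 1
  · rw [Finset.sum_eq_zero, mul_zero]
    intro p hp
    have hne : Perm.sign (swap p.1 p.2 * τ) ≠ 1 := by
      rw [sign_swap_mul_of_mem_prs hp, hτ]; decide
    simp only [evenPart, if_neg hne, mul_zero]
  · simp only [evenPart, if_neg hτ, map_zero, zero_mul]

/-- `⟪f₋, λ(Θ) f₋⟫ = 0`. [cite: CaputoLiggettRichthammer2010, §3.1] -/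
theorem l2Inner_oddPart_theta_oddPart (C : Fin n → ℝ) (f : Perm (Fin n) → ℂ) :
    l2Inner (oddPart f) (regOp n (theta C) (oddPart f)) = 0 := by
  rw [l2Inner]
  refine Finset.sum_eq_zero fun τ _ => ?_
  rw [regOp_theta_apply]
  by_cases hτ : Perm.sign τ = 1
  · simp only [oddPart, if_pos hτ, map_zero, zero_mul]
  · rw [Finset.sum_eq_zero, mul_zero]
    intro p hp
    have hτ' : Perm.sign τ = -1 := (Int.units_eq_one_or (Perm.sign τ)).resolve_left hτ
    have h1 : Perm.sign (swap p.1 p.2 * τ) = 1 := by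
      rw [sign_swap_mul_of_mem_prs hp, hτ']; decide
    simp only [oddPart, if_pos h1, mul_zero]

/-- **`Re⟪f, λ(Θ) f⟫ = 2 Re⟪f₋, λ(Θ) f₊⟫`** (the off-diagonal blocks `X`, `Xᵗ` of `C`).
[cite: CaputoLiggettRichthammer2010, §3.1] -/
theorem re_l2Inner_theta_eq_two_mul (C : Fin n → ℝ) (f : Perm (Fin n) → ℂ) :
    (l2Inner f (regOp n (theta C) f)).re =
      2 * (l2Inner (oddPart f) (regOp n (theta C) (evenPart f))).re := by
  conv_lhs => rw [← evenPart_add_oddPart f]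
  rw [map_add, l2Inner_add_left, l2Inner_add_right, l2Inner_add_right,
    l2Inner_evenPart_theta_evenPart, l2Inner_oddPart_theta_oddPart, zero_add, add_zero,
    l2Inner_theta_comm C (evenPart f) (oddPart f), ← conj_l2Inner (oddPart f), Complex.add_re,
    Complex.conj_re]
  ring

/-- Splitting a double sum over `Fin n × Fin n` by the order of the indices. [folklore] -/
theorem sum_sum_eq_sum_prs {M : Type*} [AddCommMonoid M] (G : Fin n → Fin n → M) :
    ∑ u, ∑ v, G u v = ∑ p ∈ prs n, G p.1 p.2 + ∑ u, G u u + ∑ p ∈ prs n, G p.2 p.1 := by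
  have htri : ∀ u v, G u v = (if u < v then G u v else 0) + (if u = v then G u v else 0) +
      (if v < u then G u v else 0) := by
    intro u v
    rcases lt_trichotomy u v with h | rfl | h
    · rw [if_pos h, if_neg h.ne, if_neg (not_lt.mpr h.le), add_zero, add_zero]
    · simp
    · rw [if_neg (not_lt.mpr h.le), if_neg (ne_of_gt h), if_pos h, zero_add, zero_add]
  rw [Finset.sum_congr rfl fun u _ => Finset.sum_congr rfl fun v _ => htri u v]
  simp only [Finset.sum_add_distrib]
  congr 1
  · congr 1
    · rw [sum_prs]
      refine Finset.sum_congr rfl fun u _ => ?_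
      rw [Finset.sum_filter]
    · refine Finset.sum_congr rfl fun u _ => ?_
      rw [Finset.sum_ite_eq]
      simp
  · rw [Finset.sum_comm, sum_prs]
    refine Finset.sum_congr rfl fun v _ => ?_
    rw [Finset.sum_filter]

/-- For rates with `∑_v c_v = 0`: `2 ∑_{u<v} c_u c_v = −∑_v c_v²` (so `c = ½ ∑ c_v² ≥ 0`; CLR
(relcoeff): "`c = −∑_{0≤i<j} c_ic_j`"). [cite: CaputoLiggettRichthammer2010, §3 (relcoeff)] -/
theorem two_mul_sum_prs (C : Fin n → ℝ) (hC : ∑ v, C v = 0) :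
    2 * ∑ p ∈ prs n, C p.1 * C p.2 = -∑ v, C v ^ 2 := by
  have h := sum_sum_eq_sum_prs fun u v => C u * C v
  rw [← Finset.sum_mul_sum, hC, mul_zero] at h
  have hsw : ∑ p ∈ prs n, C p.2 * C p.1 = ∑ p ∈ prs n, C p.1 * C p.2 :=
    Finset.sum_congr rfl fun p _ => mul_comm _ _
  rw [hsw] at h
  have hsq : ∑ u, C u * C u = ∑ v, C v ^ 2 := Finset.sum_congr rfl fun v _ => (sq (C v)).symm
  linarith

/-- **The key bound `Re⟪f, λ(Θ) f⟫ ≥ −c ‖f‖²`** (`c = −∑_{u<v} c_uc_v`), i.e. `C ≥ 0` for the matrix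
`C = cI + Θ` of (defC), via the block argument of CLR §3.1 and `C' ≥ 0`.
[cite: CaputoLiggettRichthammer2010, §3.1 with Lemma 3.4] -/
theorem re_l2Inner_theta_ge (x₀ : Fin n) (C : Fin n → ℝ) (hC : ∑ v, C v = 0)
    (hpos : ∀ v, v ≠ x₀ → 0 ≤ C v) (f : Perm (Fin n) → ℂ) :
    (∑ p ∈ prs n, C p.1 * C p.2) * l2NormSq f ≤ (l2Inner f (regOp n (theta C) f)).re := by
  set s := ∑ p ∈ prs n, C p.1 * C p.2 with hs
  have hs0 : s ≤ 0 := by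
    have h := two_mul_sum_prs C hC
    have : 0 ≤ ∑ v, C v ^ 2 := Finset.sum_nonneg fun v _ => sq_nonneg _
    linarith
  rcases hs0.lt_or_eq with hslt | hseq
  · -- the generic case `s < 0`: polarisation with `t = -s`
    rw [re_l2Inner_theta_eq_two_mul]
    have hpol := two_mul_re_l2Inner_ge (oddPart f) (regOp n (theta C) (evenPart f)) (neg_pos.mpr hslt)
    have hX : l2NormSq (regOp n (theta C) (evenPart f)) ≤ s ^ 2 * l2NormSq (evenPart f) := by
      rw [← l2Inner_self_re, ← l2Inner_theta_comm]
      exact re_l2Inner_theta_theta_le x₀ C hC hpos (evenPart f)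
    have hdiv : l2NormSq (regOp n (theta C) (evenPart f)) / -s ≤ -s * l2NormSq (evenPart f) := by
      rw [div_le_iff₀ (neg_pos.mpr hslt)]
      calc l2NormSq (regOp n (theta C) (evenPart f)) ≤ s ^ 2 * l2NormSq (evenPart f) := hX
        _ = -s * l2NormSq (evenPart f) * -s := by ring
    have hnorm := l2NormSq_evenPart_add f
    nlinarith [l2NormSq_nonneg (evenPart f), l2NormSq_nonneg (oddPart f)]
  · -- `s = 0`: then all rates vanish and `Θ = 0`
    have hC0 : ∀ v, C v = 0 := by
      have h := two_mul_sum_prs C hC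
      rw [← hs, hseq, mul_zero, zero_eq_neg] at h
      intro v
      have := (Finset.sum_eq_zero_iff_of_nonneg fun v _ => sq_nonneg (C v)).mp h v (Finset.mem_univ v)
      exact pow_eq_zero_iff (n := 2) (by norm_num) |>.mp this
    have hθ : theta C = 0 := by
      rw [theta]
      exact Finset.sum_eq_zero fun p _ => by rw [hC0, hC0, mul_zero, Complex.ofReal_zero, zero_smul]
    rw [hseq, zero_mul, hθ, map_zero, LinearMap.zero_apply, l2Inner_zero_right, Complex.zero_re]

/-- **The octopus inequality in symmetric form (CLR (octopus2))**: for rates `c_v`, `v ∈ Fin n`, with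
`∑_v c_v = 0` and `c_v ≥ 0` for `v ≠ x₀`, and every `f : 𝔖ₙ → ℂ`,
`∑_{u<v} c_u c_v ∑_τ ‖f((uv)τ) − f(τ)‖² ≤ 0`.
[cite: CaputoLiggettRichthammer2010, §3 (octopus2)] -/
theorem octopus_symm (x₀ : Fin n) (C : Fin n → ℝ) (hC : ∑ v, C v = 0) (hpos : ∀ v, v ≠ x₀ → 0 ≤ C v)
    (f : Perm (Fin n) → ℂ) :
    ∑ p ∈ prs n, C p.1 * C p.2 * transpDirichlet p.1 p.2 f ≤ 0 := by
  have key := re_l2Inner_theta_ge x₀ C hC hpos f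
  rw [re_l2Inner_theta] at key
  have hexp : ∑ p ∈ prs n, C p.1 * C p.2 * transpDirichlet p.1 p.2 f =
      2 * ((∑ p ∈ prs n, C p.1 * C p.2) * l2NormSq f) -
        2 * ∑ p ∈ prs n, C p.1 * C p.2 * (l2Inner f (fun τ => f (swap p.1 p.2 * τ))).re := by
    rw [Finset.sum_mul, Finset.mul_sum, Finset.mul_sum, ← Finset.sum_sub_distrib]
    refine Finset.sum_congr rfl fun p _ => ?_
    rw [transpDirichlet_eq]
    ring
  rw [hexp]
  linarith

end Parity

end Octopus

/-! ### The octopus inequality (CLR Theorem 2.3) -/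

section Main

open Octopus

/-- **The octopus inequality (Caputo–Liggett–Richthammer, Theorem 2.3).** For a weighted graph on the
vertices `Fin (m+1)` with non-negative rates `c_y` on the edges `{0, y⁺}` of the star at `0`
(`y : Fin m`), and every `f : 𝔖_{m+1} → ℂ`:
`(∑_y c_y) · ∑_y c_y ν[(∇_{0y⁺} f)²] ≥ ∑_{y<z} c_y c_z ν[(∇_{y⁺z⁺} f)²]`,
i.e. `∑_{y} c_{xy} ν[(∇_{xy} f)²] ≥ ∑_{yz} c^{*,x}_{yz} ν[(∇_{yz} f)²]` with `x = 0` and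
`c^{*,x}_{yz} = c_{xy}c_{xz}/∑_w c_{xw}` (CLR (redrates), (octopus)), multiplied through by
`∑_w c_{xw}`; here `ν[(∇_{uv} f)²] · (m+1)! = transpDirichlet u v f = ∑_τ ‖f((uv)τ) − f(τ)‖²` in the
left-regular convention of the tree (the inequality is invariant under `f ↦ f ∘ inv`).
[cite: CaputoLiggettRichthammer2010, Theorem 2.3] -/
theorem octopus_inequality (m : ℕ) (c : Fin m → ℝ) (hc : ∀ y, 0 ≤ c y) (f : Perm (Fin (m + 1)) → ℂ) :
    ∑ y : Fin m, ∑ z : Fin m with y < z, c y * c z * transpDirichlet y.succ z.succ f ≤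
      (∑ y, c y) * ∑ y, c y * transpDirichlet 0 y.succ f := by
  -- rates on `Fin (m+1)`: `C 0 = -∑ c`, `C y⁺ = c y`
  set C : Fin (m + 1) → ℝ := Fin.cons (-∑ y, c y) c with hCdef
  have hC0 : C 0 = -∑ y, c y := by simp [hCdef]
  have hCs : ∀ y : Fin m, C y.succ = c y := fun y => by simp [hCdef]
  have hC : ∑ v, C v = 0 := by rw [Fin.sum_univ_succ, hC0]; simp [hCs]
  have hpos : ∀ v, v ≠ 0 → 0 ≤ C v := by
    intro v hv
    obtain ⟨y, rfl⟩ := Fin.exists_succ_eq.mpr hv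
    rw [hCs]; exact hc y
  have key := octopus_symm 0 C hC hpos f
  rw [sum_prs, Fin.sum_univ_succ] at key
  -- the terms with `x = 0`
  have h0 : ∑ y : Fin (m + 1) with (0 : Fin (m + 1)) < y, C 0 * C y * transpDirichlet 0 y f =
      -((∑ y, c y) * ∑ y, c y * transpDirichlet 0 y.succ f) := by
    rw [Finset.sum_filter, Fin.sum_univ_succ, if_neg (lt_irrefl _), zero_add, Finset.mul_sum,
      ← Finset.sum_neg_distrib]
    refine Finset.sum_congr rfl fun y _ => ?_
    rw [if_pos (Fin.succ_pos y), hC0, hCs]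
    ring
  -- the terms with `x = y⁺`
  have h1 : ∀ y : Fin m, ∑ z : Fin (m + 1) with y.succ < z, C y.succ * C z * transpDirichlet y.succ z f =
      ∑ z : Fin m with y < z, c y * c z * transpDirichlet y.succ z.succ f := by
    intro y
    rw [Finset.sum_filter, Finset.sum_filter, Fin.sum_univ_succ, if_neg (Fin.not_lt.mpr (Fin.zero_le _)),
      zero_add]
    refine Finset.sum_congr rfl fun z _ => ?_
    simp only [Fin.succ_lt_succ_iff, hCs]
  rw [h0, Finset.sum_congr rfl fun y _ => h1 y] at key
  linarith

end Main

end Literature.RepresentationTheory.FiniteGroups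

end
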